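import Mathlib
import Literature.NumberTheory.LFunctions.Zhang2022.SkeletonPartOneB
import Literature.NumberTheory.LFunctions.Zhang2022.Section5Lemma53CaseOne
import Literature.NumberTheory.LFunctions.Zhang2022.Section5Lemma53CaseTwo
import Literature.NumberTheory.LFunctions.Zhang2022.Section5Lemma53
import HarnessLib

/-!
# Zhang (2022), typed statements §5B: Lemma 5.3, its proof (5.10)–(5.13), and (5.14)

Topic `Literature/NumberTheory/LFunctions/Zhang2022` (Landau–Siegel audit tree; verdict-neutral).
Y. Zhang, *Discrete mean estimates and the Landau–Siegel zero*, arXiv:2211.02515v1 (2022)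
[Zhang2022LandauSiegel] — **an unrefereed manuscript under adjudication; every `def … : Prop` below
is a CLAIM OF THE MANUSCRIPT, STATED NOT ASSERTED**, typed at the manuscript's own parameters
(`𝓛 = log D`, `𝓛₂ = 𝓛⁴⁰⁰`, `t₀ = 𝓛⁵¹⁹`, `s₀ = ½ + 2πit₀`, `α = π/log P`, `ε = exp{−c𝓛¹⁰}`), except where a
`_holds` theorem DISCHARGES it from theorems already in the tree (the free-parameter files
`Section5DeltaMellin`, `Section5Lemma53Phase`, `Section5Lemma53CaseOne`, `Section5Lemma53CaseTwo`,
`Section5DeltaAnalytic`, `Section2SmoothWeight`). Nothing here asserts or denies Theorems 1–2 of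
the manuscript; typed ≠ discharged. D-0069 campaign, layer L1, row L1-t9 (tex L1405–L1513,
PDF pp. 25–27 read on the page); node ids are those of the cell's `plan/DAG.tsv`.

| node | decl(s) here | status here |
|---|---|---|
| Z22:Lem5.3 | — (cited decl `Skeleton.Lemma53`); bridge `lemma53_iff` | banked node, `↔ Eq58 ∧ Eq59` proved |
| Z22:(5.8), Z22:(5.9) | `Eq58`, `Eq59` | claims |
| Z22:Lem5.3.pf | `Ded53` (the proof's assembly from (5.11), (5.12)) | claim (deduction node) |
| Z22:§5.u013 | `Step5u013` (Δ₁ as a Mellin-type integral) | claim |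
| Z22:(5.10) | `Eq510` | DISCHARGED `eq510_holds` (`Lemma53.Delta57_eq_Delta510`) |
| Z22:§5.u014 | `Step5u014` (factorisation through `f*`) | DISCHARGED `step5u014_holds` |
| Z22:§5.u015 | — (cited decl `Lemma53.fstar`, `Lemma53.fstar_def`) | tree object |
| Z22:§5.u016 | `Step5u016` (`∫ e^{2πi(t₀−x)u−𝓛₂²u²}du = ω(½+2πix)`) | DISCHARGED `step5u016_holds` |
| Z22:(5.11) | `Red58` (the Cauchy reduction), `Eq511` | `red58_holds` DISCHARGED; `Eq511` claim |
| Z22:§5.u017–u019 | objects `uStar`, `vStar`, `segL1`…`segL5`, `intL1`…`intL5` | definitions |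
| Z22:§5.u020 | `Step5u020` | DISCHARGED `step5u020_holds` |
| Z22:§5.u021, u022 | `Step5u021`, `Step5u022`, `Step5u022param` | claims; `step5u022param_holds` |
| Z22:(5.12) | `Red59` (the Cauchy reduction), `Eq512` | `red59_holds` DISCHARGED; `Eq512` claim |
| Z22:§5.u023–u024 | objects `segLp1`…`segLp3`, `intLp1`…`intLp3` | definitions |
| Z22:(5.13) | `Eq513` | DISCHARGED `eq513_holds` |
| Z22:§5.u025–u029 | `Step5u025` … `Step5u029` | all DISCHARGED (`step5u02k_holds`) |
| Z22:(5.14) | `Eq514`, `Eq514analytic` | both DISCHARGED |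

Design notes. (1) The contour integrals `∫_{L_j}`, `∫_{L′_j}` are typed as the oriented
parametrised integrals the printed segments denote (vertical segments carry the factor `i`,
orientation as printed); the segments themselves are also recorded as subsets of `ℂ` (`segL*`)
because the pointwise steps u020, u022, u025–u029 quantify over "`w ∈ L_j`". (2) The integrands are
the tree's `Lemma53.gfun` (= `exp{2πi(t₀−x)w − 𝓛₂²w²}(f*(x,w) − 1)`, `Lemma53.gfun_def`,
`Lemma53.lin_def`) and `exp ∘ Lemma53.phase` (= `exp{s₀w − 𝓛₂²w² − 2πix(e^w − 1)}`,
`Lemma53.phase_def`) at `L₂ = 𝓛₂`, `t₀`; the numbered displays (5.10), (5.13) and the defining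
displays u014, u016 are spelled out in full. (3) "`≪`" is `∃ C, … ≤ C·…` under
`Skeleton.ForAllLarge` ("`D` sufficiently large", §2 p. 4); "`O(ε)`", `ε = exp{−c𝓛¹⁰}` (§4 p. 20,
tex L1062, `c > 0` unspecified) is `C·exp(−c𝓛¹⁰)` with `∃ c > 0`. (4) `x > 0` (the domain of
`Δ`, (5.6)) is carried as a hypothesis in the case "`x ≤ t₀^{1.02}`". (5) Print slips quoted, not
fixed: (5.11) prints "`−𝓛+2²w²`" (tex `\l+2^2`) for `−𝓛₂²w²`; `L₄ = {u*+iv*, u*]` and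
`L′₁ = {−∞, −10⁻²log x]` print a brace for a bracket; "`sin v/v`" at `v = 0` is read as its limit
`1` (Mathlib `Real.sinc`) where a statement needs it (u027), and (5.13) as printed holds for every
`v` with Lean's `0/0 = 0`. (6) No new named fact: the Mellin pair "[1], Lemma 2" behind (5.10) is
not taken as a hypothesis — (5.6)–(5.7) ⇒ (5.10) is the tree's theorem
`Lemma53.Delta57_eq_Delta510`.

## References

* Y. Zhang, arXiv:2211.02515v1 (2022), §5 pp. 25–27, Lemma 5.3, (5.8)–(5.14).
  [cite: Zhang2022LandauSiegel, §5 pp. 25–27]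
-/

noncomputable section

open Complex Real Set MeasureTheory intervalIntegral

open Literature.NumberTheory.LFunctions.Zhang2022

namespace Literature.NumberTheory.LFunctions.Zhang2022.Section5

/-! ## Small facts about the parameters (`D ≥ 3`) -/

/-- `𝓛 = log D ≥ 0` for every natural `D`. [folklore] -/
private theorem ell_nonneg (D : ℕ) : 0 ≤ Skeleton.ell D := Real.log_natCast_nonneg D

/-- `𝓛 = log D > 1` for `D ≥ 3`. [folklore] -/
private theorem one_lt_ell {D : ℕ} (hD : 3 ≤ D) : 1 < Skeleton.ell D := by
  have hD' : (3 : ℝ) ≤ D := by exact_mod_cast hD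
  rw [Skeleton.ell]
  calc (1 : ℝ) < Real.log 3 := by
        rw [Real.lt_log_iff_exp_lt (by norm_num)]
        exact Real.exp_one_lt_d9.trans (by norm_num)
    _ ≤ Real.log D := Real.log_le_log (by norm_num) hD'

/-- `𝓛₂ = 𝓛⁴⁰⁰ ≥ 1` for `D ≥ 3`. [folklore] -/
private theorem one_le_ell2 {D : ℕ} (hD : 3 ≤ D) : 1 ≤ Skeleton.ell2 D := by
  rw [Skeleton.ell2]; exact one_le_pow₀ (one_lt_ell hD).le

/-- `𝓛₂ > 0` for `D ≥ 3`. [folklore] -/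
private theorem ell2_pos {D : ℕ} (hD : 3 ≤ D) : 0 < Skeleton.ell2 D :=
  lt_of_lt_of_le one_pos (one_le_ell2 hD)

/-- `t₀ = 𝓛⁵¹⁹ ≥ 0`. [folklore] -/
private theorem t0_nonneg (D : ℕ) : 0 ≤ Skeleton.t0 D := by
  rw [Skeleton.t0]; exact pow_nonneg (ell_nonneg D) _

/-- `t₀ ≥ 1` for `D ≥ 3`. [folklore] -/
private theorem one_le_t0 {D : ℕ} (hD : 3 ≤ D) : 1 ≤ Skeleton.t0 D := by
  rw [Skeleton.t0]; exact one_le_pow₀ (one_lt_ell hD).le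

/-- `α = π/log P = π/𝓛⁹` ((2.6), (2.10)). [cite: Zhang2022LandauSiegel, §2 (2.10)] -/
private theorem alpha_eq (D : ℕ) : Skeleton.alpha D = π / Skeleton.ell D ^ 9 := by
  rw [Skeleton.alpha, Skeleton.bigP, Real.log_exp]

/-- `α ≥ 0`. [folklore] -/
private theorem alpha_nonneg (D : ℕ) : 0 ≤ Skeleton.alpha D := by
  rw [alpha_eq]; exact div_nonneg Real.pi_pos.le (pow_nonneg (ell_nonneg D) _)

/-! ## Lemma 5.3: the two displays (5.8), (5.9) (the lemma itself is the banked node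
`Skeleton.Lemma53`) -/

/-- Z22:(5.8) [Z22 p.25, (5.8), tex L1407] «If `x ≤ t₀^{1.02}`, then
`Δ(x) = ω(1/2+2πix)(1 + O(α)) + O(ε)`» (`ε = exp{−c𝓛¹⁰}`; `x > 0`, the domain of `Δ`); the first
half of the banked node `Skeleton.Lemma53` (`lemma53_iff`). CLAIM.
[cite: Zhang2022LandauSiegel, §5 Lemma 5.3 (5.8) p.25] -/
def Eq58 : Prop :=
  ∃ c : ℝ, 0 < c ∧ ∃ C : ℝ, Skeleton.ForAllLarge fun D _ _ => ∀ x : ℝ, 0 < x →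
    x ≤ Skeleton.t0 D ^ (1.02 : ℝ) →
      ‖Skeleton.DeltaW D x - Skeleton.omegaW D (1 / 2 + 2 * π * x * I)‖
        ≤ C * Skeleton.alpha D * ‖Skeleton.omegaW D (1 / 2 + 2 * π * x * I)‖
          + Real.exp (-c * Skeleton.ell D ^ 10)

/-- Z22:(5.9) [Z22 p.25, (5.9), tex L1411] «if `x > t₀^{1.02}`, then
`Δ(x) ≪ exp{−(10⁻²𝓛₂ log x)²} + exp{−x^{0.99}/𝓛₂}`»; the second half of the banked node
`Skeleton.Lemma53` (`lemma53_iff`). CLAIM. [cite: Zhang2022LandauSiegel, §5 Lemma 5.3 (5.9) p.25] -/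
def Eq59 : Prop :=
  ∃ C : ℝ, Skeleton.ForAllLarge fun D _ _ => ∀ x : ℝ, Skeleton.t0 D ^ (1.02 : ℝ) < x →
    ‖Skeleton.DeltaW D x‖ ≤ C * (Real.exp (-((1 : ℝ) / 100 * Skeleton.ell2 D * Real.log x) ^ 2) +
      Real.exp (-(x ^ (0.99 : ℝ)) / Skeleton.ell2 D))

/-- **Z22:Lem5.3 = (5.8) ∧ (5.9)**: the banked node `Skeleton.Lemma53` is equivalent to the
conjunction of the two typed displays (same `c`; the constant `C` of the node is the larger of the
two). EDGE, kernel-checked. [cite: Zhang2022LandauSiegel, §5 Lemma 5.3 p.25] -/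
theorem lemma53_iff : Skeleton.Lemma53 ↔ Eq58 ∧ Eq59 := by
  constructor
  · rintro ⟨c, hc, C, D₀, h⟩
    refine ⟨⟨c, hc, C, D₀, fun D _ χ hD hq hp x hx hle => ((h D χ hD hq hp) x hx).1 hle⟩,
      ⟨C, D₀, fun D _ χ hD hq hp x hlt => ((h D χ hD hq hp) x ?_).2 hlt⟩⟩
    exact lt_of_le_of_lt (Real.rpow_nonneg (t0_nonneg D) _) hlt
  · rintro ⟨⟨c, hc, C₁, D₁, h₁⟩, ⟨C₂, D₂, h₂⟩⟩
    refine ⟨c, hc, max C₁ C₂, max D₁ D₂, fun D _ χ hD hq hp x hx => ⟨fun hle => ?_, fun hlt => ?_⟩⟩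
    · have h := h₁ D χ (le_trans (le_max_left _ _) hD) hq hp x hx hle
      have hα : 0 ≤ Skeleton.alpha D * ‖Skeleton.omegaW D (1 / 2 + 2 * π * x * I)‖ :=
        mul_nonneg (alpha_nonneg D) (norm_nonneg _)
      refine h.trans ?_
      nlinarith [le_max_left C₁ C₂, hα]
    · have h := h₂ D χ (le_trans (le_max_right _ _) hD) hq hp x hlt
      exact h.trans (mul_le_mul_of_nonneg_right (le_max_right _ _) (by positivity))

/-! ## The proof of Lemma 5.3: (5.10) and the case `x ≤ t₀^{1.02}` -/

/-- Z22:§5.u013 [Z22 p.26, tex L1420] «By the Mellin transform (see [1], Lemma 2) we have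
`Δ₁(x) = ∫₀^∞ exp{(s₀ − 1)log y − 𝓛₂² log² y − 2πixy} dy` where the logarithm vanishes at `y = 1`»
(`Δ₁` of (5.6) = the tree's `Lemma53.Delta1_56` at `𝓛₂, t₀`; `x > 0`; real logarithm);
refines `Skeleton.Lemma53`'s proof (`Ded53`, step 1). CLAIM.
[cite: Zhang2022LandauSiegel, §5 p.26] -/
def Step5u013 : Prop :=
  Skeleton.ForAllLarge fun D _ _ => ∀ x : ℝ, 0 < x →
    Lemma53.Delta1_56 (Skeleton.ell2 D) (Skeleton.t0 D) x =
      ∫ y in Ioi (0 : ℝ), cexp ((Skeleton.s0 D - 1) * (Real.log y : ℂ)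
        - (Skeleton.ell2 D : ℂ) ^ 2 * (Real.log y : ℂ) ^ 2 - 2 * π * I * x * y)

/-- Z22:(5.10) [Z22 p.26, (5.10), tex L1424] «This yields, by substituting `y = e^u`,
`Δ(x) = ∫_{−∞}^{∞} exp{s₀u − 𝓛₂²u² − 2πix(e^u − 1)} du`» (`Δ` of (5.7) = `Skeleton.DeltaW`; `x > 0`).
CLAIM — and a THEOREM of the tree (`eq510_holds`). [cite: Zhang2022LandauSiegel, §5 (5.10) p.26] -/
def Eq510 : Prop :=
  Skeleton.ForAllLarge fun D _ _ => ∀ x : ℝ, 0 < x →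
    Skeleton.DeltaW D x = ∫ u : ℝ, cexp (Skeleton.s0 D * u - (Skeleton.ell2 D : ℂ) ^ 2 * (u : ℂ) ^ 2
      - 2 * π * I * x * (cexp u - 1))

/-- **(5.10) holds**: (5.6)–(5.7) ⇒ (5.10) is the tree's `Lemma53.Delta57_eq_Delta510` (the step
"[1], Lemma 2" kernel-checked there; no named fact is used). [cite: Zhang2022LandauSiegel, §5 (5.10) p.26] -/
theorem eq510_holds : Eq510 := by
  refine Skeleton.ForAllLarge.of_le 3 fun D _ _ hD _ _ x hx => ?_
  rw [Skeleton.DeltaW, Lemma53.Delta57_eq_Delta510 (ell2_pos hD) _ hx]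
  simp only [Lemma53.Delta510, Lemma53.phase_def, Skeleton.s0, SmoothWeight.s0_def]

/-- Z22:§5.u014 [Z22 p.26, tex L1429] «First assume `x ≤ t₀^{1.02}`. We may write
`exp{s₀w − 𝓛₂²w² − 2πix(e^w − 1)} = exp{2πi(t₀ − x)w − 𝓛₂²w²} f*(x,w)`» with `f*` as in u015
(= the tree's `Lemma53.fstar`); an exact identity for every `w` (typed for all `D`, `x`, `w`).
CLAIM — and a THEOREM of the tree (`step5u014_holds`). [cite: Zhang2022LandauSiegel, §5 p.26] -/
def Step5u014 : Prop :=
  ∀ (D : ℕ) (x : ℝ) (w : ℂ),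
    cexp (Skeleton.s0 D * w - (Skeleton.ell2 D : ℂ) ^ 2 * w ^ 2 - 2 * π * I * x * (cexp w - 1))
      = cexp (2 * π * I * ((Skeleton.t0 D : ℂ) - x) * w - (Skeleton.ell2 D : ℂ) ^ 2 * w ^ 2)
        * Lemma53.fstar x w

/-- **u014 holds** (`Lemma53.cexp_phase_eq_mul_fstar`). [cite: Zhang2022LandauSiegel, §5 p.26] -/
theorem step5u014_holds : Step5u014 := by
  intro D x w
  have h := Lemma53.cexp_phase_eq_mul_fstar (Skeleton.ell2 D) (Skeleton.t0 D) x w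
  simpa only [Lemma53.phase_def, Lemma53.lin_def, Skeleton.s0, SmoothWeight.s0_def] using h

/-- Z22:§5.u016 [Z22 p.26, tex L1437] «By the relation
`∫_{−∞}^{∞} exp{2πi(t₀ − x)u − 𝓛₂²u²} du = ω(1/2 + 2πix)` …» (`ω` of (2.15) = `Skeleton.omegaW`).
CLAIM — and a THEOREM of the tree (`step5u016_holds`). [cite: Zhang2022LandauSiegel, §5 p.26] -/
def Step5u016 : Prop :=
  Skeleton.ForAllLarge fun D _ _ => ∀ x : ℝ,
    ∫ u : ℝ, cexp (2 * π * I * ((Skeleton.t0 D : ℂ) - x) * u - (Skeleton.ell2 D : ℂ) ^ 2 * (u : ℂ) ^ 2)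
      = Skeleton.omegaW D (1 / 2 + 2 * π * x * I)

/-- **u016 holds** (`SmoothWeight.integral_cexp_phase_eq_omega`). [cite: Zhang2022LandauSiegel, §5 p.26] -/
theorem step5u016_holds : Step5u016 := by
  refine Skeleton.ForAllLarge.of_le 3 fun D _ _ hD _ _ x => ?_
  rw [Skeleton.omegaW]
  exact SmoothWeight.integral_cexp_phase_eq_omega (ell2_pos hD) _ x

/-- Z22:§5.u019 (first half) [Z22 p.26, tex L1452] «`u* = 𝓛₂⁻¹𝓛⁵`». Object.
[cite: Zhang2022LandauSiegel, §5 p.26] -/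
def uStar (D : ℕ) : ℝ := (Skeleton.ell2 D)⁻¹ * Skeleton.ell D ^ 5

/-- Z22:§5.u019 (second half) [Z22 p.26, tex L1452] «`v* = π(t₀ − x)/𝓛₂²`». Object.
[cite: Zhang2022LandauSiegel, §5 p.26] -/
def vStar (D : ℕ) (x : ℝ) : ℝ := π * (Skeleton.t0 D - x) / Skeleton.ell2 D ^ 2

/-- Z22:§5.u017 [Z22 p.26, tex L1445] «`L₁ = (−∞, −u*]`» as a subset of `ℂ` (on the real axis).
Object. [cite: Zhang2022LandauSiegel, §5 p.26] -/
def segL1 (D : ℕ) : Set ℂ := {w | w.im = 0 ∧ w.re ≤ -uStar D}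

/-- Z22:§5.u017 [Z22 p.26, tex L1445] «`L₂ = [−u*, −u* + iv*]`» (vertical). Object.
[cite: Zhang2022LandauSiegel, §5 p.26] -/
def segL2 (D : ℕ) (x : ℝ) : Set ℂ := {w | w.re = -uStar D ∧ w.im ∈ uIcc 0 (vStar D x)}

/-- Z22:§5.u017 [Z22 p.26, tex L1445] «`L₃ = [−u* + iv*, u* + iv*]`» (horizontal). Object.
[cite: Zhang2022LandauSiegel, §5 p.26] -/
def segL3 (D : ℕ) (x : ℝ) : Set ℂ := {w | w.im = vStar D x ∧ w.re ∈ Icc (-uStar D) (uStar D)}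

/-- Z22:§5.u018 [Z22 p.26, tex L1448] «`L₄ = {u* + iv*, u*]`» (print: brace for bracket, sic;
the vertical segment from `u* + iv*` down to `u*`). Object. [cite: Zhang2022LandauSiegel, §5 p.26] -/
def segL4 (D : ℕ) (x : ℝ) : Set ℂ := {w | w.re = uStar D ∧ w.im ∈ uIcc 0 (vStar D x)}

/-- Z22:§5.u018 [Z22 p.26, tex L1448] «`L₅ = [u*, ∞)`» (on the real axis). Object.
[cite: Zhang2022LandauSiegel, §5 p.26] -/
def segL5 (D : ℕ) : Set ℂ := {w | w.im = 0 ∧ uStar D ≤ w.re}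

/-- `∫_{L₁}` of the integrand of (5.11), `g(w) = exp{2πi(t₀−x)w − 𝓛₂²w²}(f*(x,w) − 1)` (the tree's
`Lemma53.gfun` at `𝓛₂, t₀`): `∫_{u ≤ −u*} g(u) du`. Object. [cite: Zhang2022LandauSiegel, §5 (5.11) p.26] -/
def intL1 (D : ℕ) (x : ℝ) : ℂ :=
  ∫ u in Iic (-uStar D), Lemma53.gfun (Skeleton.ell2 D) (Skeleton.t0 D) x u

/-- `∫_{L₂} g(w) dw = i∫₀^{v*} g(−u* + iy) dy` (oriented from `−u*` to `−u* + iv*`). Object.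
[cite: Zhang2022LandauSiegel, §5 (5.11) p.26] -/
def intL2 (D : ℕ) (x : ℝ) : ℂ :=
  I * ∫ y in (0 : ℝ)..vStar D x, Lemma53.gfun (Skeleton.ell2 D) (Skeleton.t0 D) x (-uStar D + y * I)

/-- `∫_{L₃} g(w) dw = ∫_{−u*}^{u*} g(u + iv*) du`. Object. [cite: Zhang2022LandauSiegel, §5 (5.11) p.26] -/
def intL3 (D : ℕ) (x : ℝ) : ℂ :=
  ∫ u in (-uStar D)..uStar D, Lemma53.gfun (Skeleton.ell2 D) (Skeleton.t0 D) x (u + vStar D x * I)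

/-- `∫_{L₄} g(w) dw = i∫_{v*}^{0} g(u* + iy) dy` (oriented from `u* + iv*` to `u*`, as printed).
Object. [cite: Zhang2022LandauSiegel, §5 (5.11) p.26] -/
def intL4 (D : ℕ) (x : ℝ) : ℂ :=
  I * ∫ y in vStar D x..(0 : ℝ), Lemma53.gfun (Skeleton.ell2 D) (Skeleton.t0 D) x (uStar D + y * I)

/-- `∫_{L₅} g(w) dw = ∫_{u ≥ u*} g(u) du`. Object. [cite: Zhang2022LandauSiegel, §5 (5.11) p.26] -/
def intL5 (D : ℕ) (x : ℝ) : ℂ :=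
  ∫ u in Ici (uStar D), Lemma53.gfun (Skeleton.ell2 D) (Skeleton.t0 D) x u

/-- Z22:(5.11), the reduction [Z22 p.26, tex L1437–L1440] «By the relation (u016) and Cauchy's
theorem, the proof of (5.8) is reduced to showing that (5.11) for `1 ≤ j ≤ 5`», i.e. the claim
`Δ(x) − ω(1/2 + 2πix) = Σ_{j=1}^{5} ∫_{L_j} g(w) dw` (`x > 0`). CLAIM — and a THEOREM of the tree
(`red58_holds`: Cauchy–Goursat for the rectangle `[−u*, u*] × [0, v*]`).
[cite: Zhang2022LandauSiegel, §5 (5.11) p.26] -/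
def Red58 : Prop :=
  Skeleton.ForAllLarge fun D _ _ => ∀ x : ℝ, 0 < x →
    Skeleton.DeltaW D x - Skeleton.omegaW D (1 / 2 + 2 * π * x * I)
      = intL1 D x + intL2 D x + intL3 D x + intL4 D x + intL5 D x

/-- **The reduction to (5.11) holds** (`Lemma53.Delta510_sub_omega_eq`,
`Lemma53.integral_gfun_eq_split`). [cite: Zhang2022LandauSiegel, §5 (5.11) p.26] -/
theorem red58_holds : Red58 := by
  refine Skeleton.ForAllLarge.of_le 3 fun D _ _ hD _ _ x hx => ?_
  have hL := ell2_pos hD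
  rw [Skeleton.DeltaW, Skeleton.omegaW, Lemma53.Delta57_eq_Delta510 hL _ hx,
    Lemma53.Delta510_sub_omega_eq hL, Lemma53.integral_gfun_eq_split hL.ne' _ x (uStar D) (vStar D x),
    intL1, intL2, intL3, intL4, intL5, integral_Ici_eq_integral_Ioi,
    intervalIntegral.integral_symm (0 : ℝ) (vStar D x)]
  ring

/-- Z22:(5.11) [Z22 p.26, (5.11), tex L1441] «`∫_{L_j} exp{2πi(t₀ − x)w − 𝓛₂²w²}(f*(x,w) − 1) dw
≪ α ω(1/2 + 2πix) + ε` for `1 ≤ j ≤ 5`» (print: "`−𝓛+2²w²`", tex `\l+2^2`, sic, for `−𝓛₂²w²`;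
case `0 < x ≤ t₀^{1.02}`; `ε = exp{−c𝓛¹⁰}`). CLAIM (refines `Skeleton.Lemma53`'s proof, `Ded53`).
[cite: Zhang2022LandauSiegel, §5 (5.11) p.26] -/
def Eq511 : Prop :=
  ∃ c : ℝ, 0 < c ∧ ∃ C : ℝ, Skeleton.ForAllLarge fun D _ _ => ∀ x : ℝ, 0 < x →
    x ≤ Skeleton.t0 D ^ (1.02 : ℝ) →
      let B := C * (Skeleton.alpha D * ‖Skeleton.omegaW D (1 / 2 + 2 * π * x * I)‖
        + Real.exp (-c * Skeleton.ell D ^ 10))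
      ‖intL1 D x‖ ≤ B ∧ ‖intL2 D x‖ ≤ B ∧ ‖intL3 D x‖ ≤ B ∧ ‖intL4 D x‖ ≤ B ∧ ‖intL5 D x‖ ≤ B

/-- Z22:§5.u020 [Z22 p.26, tex L1458] «If `w ∈ L₁ ∪ L₅`, then
`exp{2πi(t₀ − x)w − 𝓛₂²w²}(f*(x,w) − 1) ≪ exp{−𝓛₂²u²}(1 + e^{u/2})`» (`u = Re w`; case
`0 < x ≤ t₀^{1.02}`). CLAIM — and a THEOREM of the tree (`step5u020_holds`, constant `1`, in fact for
every real `w`). [cite: Zhang2022LandauSiegel, §5 p.26] -/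
def Step5u020 : Prop :=
  ∃ C : ℝ, Skeleton.ForAllLarge fun D _ _ => ∀ x : ℝ, 0 < x → x ≤ Skeleton.t0 D ^ (1.02 : ℝ) →
    ∀ w ∈ segL1 D ∪ segL5 D,
      ‖Lemma53.gfun (Skeleton.ell2 D) (Skeleton.t0 D) x w‖
        ≤ C * (Real.exp (-(Skeleton.ell2 D ^ 2 * w.re ^ 2)) * (1 + Real.exp (w.re / 2)))

/-- **u020 holds** (`Lemma53.norm_lin_mul_fstar_sub_one_le`). [cite: Zhang2022LandauSiegel, §5 p.26] -/
theorem step5u020_holds : Step5u020 := by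
  refine ⟨1, Skeleton.ForAllLarge.of_le 0 fun D _ _ _ _ _ x _ _ w hw => ?_⟩
  have him : w.im = 0 := by
    rcases hw with ⟨h, -⟩ | ⟨h, -⟩
    · exact h
    · exact h
  have hw' : w = (w.re : ℂ) := Complex.ext (by simp) (by simp [him])
  have key := Lemma53.norm_lin_mul_fstar_sub_one_le (Skeleton.ell2 D) (Skeleton.t0 D) x w.re
  rw [← hw'] at key
  rw [one_mul, Lemma53.gfun_def]
  exact key

/-- «Thus the left side of (5.11) is trivially `O(ε)` if `j = 1, 5`» [Z22 p.26, tex L1460]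
(case `0 < x ≤ t₀^{1.02}`): `∫_{L₁}, ∫_{L₅} ≪ ε`. CLAIM (refines (5.11) for `j = 1, 5`).
[cite: Zhang2022LandauSiegel, §5 p.26] -/
def Step5u020tail : Prop :=
  ∃ c : ℝ, 0 < c ∧ ∃ C : ℝ, Skeleton.ForAllLarge fun D _ _ => ∀ x : ℝ, 0 < x →
    x ≤ Skeleton.t0 D ^ (1.02 : ℝ) →
      ‖intL1 D x‖ + ‖intL5 D x‖ ≤ C * Real.exp (-c * Skeleton.ell D ^ 10)

/-- Z22:§5.u021 [Z22 p.26, tex L1462] «By simple estimates,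
`∫_{L_j} |exp{2πi(t₀ − x)w − 𝓛₂²w²} dw| ≪ ω(1/2 + 2πix) + ε` if `j = 2, 3, 4`» (arc-length integrals
of the modulus of `exp{lin(w)}`, `lin` = the tree's `Lemma53.lin`; case `0 < x ≤ t₀^{1.02}`). CLAIM.
[cite: Zhang2022LandauSiegel, §5 p.26] -/
def Step5u021 : Prop :=
  ∃ c : ℝ, 0 < c ∧ ∃ C : ℝ, Skeleton.ForAllLarge fun D _ _ => ∀ x : ℝ, 0 < x →
    x ≤ Skeleton.t0 D ^ (1.02 : ℝ) →
      let B := C * (‖Skeleton.omegaW D (1 / 2 + 2 * π * x * I)‖ + Real.exp (-c * Skeleton.ell D ^ 10))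
      (∫ y in uIcc 0 (vStar D x),
          ‖cexp (Lemma53.lin (Skeleton.ell2 D) (Skeleton.t0 D) x (-uStar D + y * I))‖) ≤ B ∧
      (∫ u in Icc (-uStar D) (uStar D),
          ‖cexp (Lemma53.lin (Skeleton.ell2 D) (Skeleton.t0 D) x (u + vStar D x * I))‖) ≤ B ∧
      (∫ y in uIcc 0 (vStar D x),
          ‖cexp (Lemma53.lin (Skeleton.ell2 D) (Skeleton.t0 D) x (uStar D + y * I))‖) ≤ B

/-- Z22:§5.u022 (the reason) [Z22 p.26, tex L1466] «Since `t₀^{3.06}/𝓛₂⁴ ≪ α` …». CLAIM — and a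
THEOREM (`step5u022param_holds`: `t₀^{3.06}𝓛₂⁻⁴ = 𝓛^{1588.14 − 1600} ≤ 𝓛⁻⁹ ≤ α` for `𝓛 ≥ 1`).
[cite: Zhang2022LandauSiegel, §5 p.26] -/
def Step5u022param : Prop :=
  ∃ C : ℝ, Skeleton.ForAllLarge fun D _ _ =>
    Skeleton.t0 D ^ (3.06 : ℝ) / Skeleton.ell2 D ^ 4 ≤ C * Skeleton.alpha D

/-- **"`t₀^{3.06}/𝓛₂⁴ ≪ α`" holds** (exponent bookkeeping: `519 · 3.06 = 1588.14 < 1600 − 9`).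
[cite: Zhang2022LandauSiegel, §5 p.26] -/
theorem step5u022param_holds : Step5u022param := by
  refine ⟨1, Skeleton.ForAllLarge.of_le 3 fun D _ _ hD _ _ => ?_⟩
  have hℓ : 1 < Skeleton.ell D := one_lt_ell hD
  have hℓ0 : 0 < Skeleton.ell D := lt_trans one_pos hℓ
  rw [alpha_eq, one_mul, Skeleton.t0, Skeleton.ell2, ← Real.rpow_natCast (Skeleton.ell D) 519,
    ← Real.rpow_mul hℓ0.le, ← pow_mul, div_le_div_iff₀ (pow_pos hℓ0 _) (pow_pos hℓ0 _)]
  have h1 : Skeleton.ell D ^ ((519 : ℕ) * (3.06 : ℝ)) * Skeleton.ell D ^ 9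
      = Skeleton.ell D ^ (1597.14 : ℝ) := by
    rw [← Real.rpow_natCast (Skeleton.ell D) 9, ← Real.rpow_add hℓ0]; norm_num
  have h2 : Skeleton.ell D ^ (400 * 4) = Skeleton.ell D ^ (1600 : ℝ) := by
    rw [← Real.rpow_natCast]; norm_num
  rw [h1, h2]
  calc Skeleton.ell D ^ (1597.14 : ℝ) ≤ Skeleton.ell D ^ (1600 : ℝ) :=
        Real.rpow_le_rpow_of_exponent_le hℓ.le (by norm_num)
    _ ≤ π * Skeleton.ell D ^ (1600 : ℝ) := by
        have h0 : 0 ≤ Skeleton.ell D ^ (1600 : ℝ) := Real.rpow_nonneg hℓ0.le _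
        nlinarith [Real.pi_gt_three]

/-- Z22:§5.u022 [Z22 pp.26–27, tex L1467] «we have `f*(x,w) − 1 ≪ |w| + x|w|² ≪ α` for
`w ∈ L₂ ∪ L₃ ∪ L₄`» (case `0 < x ≤ t₀^{1.02}`; both `≪` typed). CLAIM (pointwise input:
`Lemma53.norm_fstar_sub_one_le`). [cite: Zhang2022LandauSiegel, §5 pp.26–27] -/
def Step5u022 : Prop :=
  ∃ C : ℝ, Skeleton.ForAllLarge fun D _ _ => ∀ x : ℝ, 0 < x → x ≤ Skeleton.t0 D ^ (1.02 : ℝ) →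
    ∀ w ∈ segL2 D x ∪ segL3 D x ∪ segL4 D x,
      ‖Lemma53.fstar x w - 1‖ ≤ C * (‖w‖ + x * ‖w‖ ^ 2) ∧ ‖w‖ + x * ‖w‖ ^ 2 ≤ C * Skeleton.alpha D

/-! ## The proof of Lemma 5.3: the case `x > t₀^{1.02}` -/

/-- Z22:§5.u023 [Z22 p.27, tex L1477] «`L′₁ = {−∞, −10⁻²log x]`» (print: brace for bracket, sic;
on the real axis). Object. [cite: Zhang2022LandauSiegel, §5 p.27] -/
def segLp1 (x : ℝ) : Set ℂ := {w | w.im = 0 ∧ w.re ≤ -((1 : ℝ) / 100 * Real.log x)}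

/-- Z22:§5.u023 [Z22 p.27, tex L1477] «`L′₂ = [−10⁻²log x, −10⁻²log x − i/𝓛₂]`» (vertical,
downwards). Object. [cite: Zhang2022LandauSiegel, §5 p.27] -/
def segLp2 (D : ℕ) (x : ℝ) : Set ℂ :=
  {w | w.re = -((1 : ℝ) / 100 * Real.log x) ∧ w.im ∈ Icc (-(1 / Skeleton.ell2 D)) 0}

/-- Z22:§5.u024 [Z22 p.27, tex L1479] «`L′₃ = [−10⁻²log x − i/𝓛₂, ∞ − i/𝓛₂)`» (horizontal line
`Im w = −1/𝓛₂`). Object. [cite: Zhang2022LandauSiegel, §5 p.27] -/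
def segLp3 (D : ℕ) (x : ℝ) : Set ℂ :=
  {w | w.im = -(1 / Skeleton.ell2 D) ∧ -((1 : ℝ) / 100 * Real.log x) ≤ w.re}

/-- `∫_{L′₁}` of the integrand of (5.10)/(5.12), `exp{s₀w − 𝓛₂²w² − 2πix(e^w − 1)}` (= `exp` of the
tree's `Lemma53.phase` at `𝓛₂, t₀`): `∫_{u ≤ −10⁻²log x} e^{phase(u)} du`. Object.
[cite: Zhang2022LandauSiegel, §5 (5.12) p.27] -/
def intLp1 (D : ℕ) (x : ℝ) : ℂ :=
  ∫ u in Iic (-((1 : ℝ) / 100 * Real.log x)), cexp (Lemma53.phase (Skeleton.ell2 D) (Skeleton.t0 D) x u)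

/-- `∫_{L′₂} e^{phase(w)} dw = i∫₀^{−1/𝓛₂} e^{phase(−10⁻²log x + iy)} dy` (oriented downwards, as
printed). Object. [cite: Zhang2022LandauSiegel, §5 (5.12) p.27] -/
def intLp2 (D : ℕ) (x : ℝ) : ℂ :=
  I * ∫ y in (0 : ℝ)..(-(1 / Skeleton.ell2 D)),
    cexp (Lemma53.phase (Skeleton.ell2 D) (Skeleton.t0 D) x ((-((1 : ℝ) / 100 * Real.log x) : ℝ) + y * I))

/-- `∫_{L′₃} e^{phase(w)} dw = ∫_{u ≥ −10⁻²log x} e^{phase(u − i/𝓛₂)} du`. Object.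
[cite: Zhang2022LandauSiegel, §5 (5.12) p.27] -/
def intLp3 (D : ℕ) (x : ℝ) : ℂ :=
  ∫ u in Ici (-((1 : ℝ) / 100 * Real.log x)),
    cexp (Lemma53.phase (Skeleton.ell2 D) (Skeleton.t0 D) x (u + (-(1 / Skeleton.ell2 D) : ℝ) * I))

/-- Z22:(5.12), the reduction [Z22 p.27, tex L1471] «Now assume `x > t₀^{1.02}`. By Cauchy's
theorem, the proof of (5.9) is reduced to showing that (5.12)», i.e. the claim
`Δ(x) = Σ_{j=1}^{3} ∫_{L′_j} e^{phase(w)} dw`. CLAIM — and a THEOREM of the tree (`red59_holds`: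
`Lemma53.Delta510_eq_contour`, the strip `[−10⁻²log x, ∞) × [−1/𝓛₂, 0]`).
[cite: Zhang2022LandauSiegel, §5 (5.12) p.27] -/
def Red59 : Prop :=
  Skeleton.ForAllLarge fun D _ _ => ∀ x : ℝ, Skeleton.t0 D ^ (1.02 : ℝ) < x →
    Skeleton.DeltaW D x = intLp1 D x + intLp2 D x + intLp3 D x

/-- **The reduction to (5.12) holds** (`Lemma53.Delta510_eq_contour`).
[cite: Zhang2022LandauSiegel, §5 (5.12) p.27] -/
theorem red59_holds : Red59 := by
  refine Skeleton.ForAllLarge.of_le 3 fun D _ _ hD _ _ x hx => ?_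
  have hx0 : 0 < x := lt_of_le_of_lt (Real.rpow_nonneg (t0_nonneg D) _) hx
  rw [Skeleton.DeltaW, Lemma53.Delta57_eq_Delta510 (ell2_pos hD) _ hx0,
    Lemma53.Delta510_eq_contour (one_le_ell2 hD) _ hx0.le (-((1 : ℝ) / 100 * Real.log x)),
    intLp1, intLp2, intLp3, integral_Ici_eq_integral_Ioi,
    intervalIntegral.integral_symm (-(1 / Skeleton.ell2 D)) (0 : ℝ)]
  ring

/-- Z22:(5.12) [Z22 p.27, (5.12), tex L1473] «`∫_{L′_j} exp{s₀w − 𝓛₂²w² − 2πix(e^w − 1)} dw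
≪ exp{−(10⁻²𝓛₂ log x)²} + exp{−x^{0.99}/𝓛₂}`» for `j = 1, 2, 3` (case `x > t₀^{1.02}`). CLAIM
(refines `Skeleton.Lemma53`'s proof, `Ded53`; the tree's explicit forms are
`Lemma53.norm_integral_L1'_le / L2'_le / L3'_le`). [cite: Zhang2022LandauSiegel, §5 (5.12) p.27] -/
def Eq512 : Prop :=
  ∃ C : ℝ, Skeleton.ForAllLarge fun D _ _ => ∀ x : ℝ, Skeleton.t0 D ^ (1.02 : ℝ) < x →
    let R := Real.exp (-((1 : ℝ) / 100 * Skeleton.ell2 D * Real.log x) ^ 2) +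
      Real.exp (-(x ^ (0.99 : ℝ)) / Skeleton.ell2 D)
    ‖intLp1 D x‖ ≤ C * R ∧ ‖intLp2 D x‖ ≤ C * R ∧ ‖intLp3 D x‖ ≤ C * R

/-- Z22:(5.13) [Z22 p.27, (5.13), tex L1483] «We have
`Re{s₀w − 𝓛₂²w² − 2πix(e^w − 1)} = ½u − 𝓛₂²(u² − v²) + 2πv(xe^u sin v/v − t₀)`» (`w = u + iv`; as
printed, with `sin v/v`; at `v = 0` both sides equal `½u − 𝓛₂²u²`, Lean's `0/0 = 0`). CLAIM — and
a THEOREM of the tree (`eq513_holds`, `Lemma53.re_phase_eq`). [cite: Zhang2022LandauSiegel, §5 (5.13) p.27] -/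
def Eq513 : Prop :=
  ∀ (D : ℕ) (x u v : ℝ),
    (Skeleton.s0 D * (u + v * I) - (Skeleton.ell2 D : ℂ) ^ 2 * (u + v * I) ^ 2
        - 2 * π * I * x * (cexp (u + v * I) - 1)).re
      = u / 2 - Skeleton.ell2 D ^ 2 * (u ^ 2 - v ^ 2)
        + 2 * π * v * (x * Real.exp u * Real.sin v / v - Skeleton.t0 D)

/-- **(5.13) holds** (`Lemma53.re_phase_eq`, with `v·sinc v = sin v`). [cite: Zhang2022LandauSiegel, §5 (5.13) p.27] -/
theorem eq513_holds : Eq513 := by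
  intro D x u v
  have h := Lemma53.re_phase_eq (Skeleton.ell2 D) (Skeleton.t0 D) x u v
  rw [Lemma53.phase_def] at h
  rw [Skeleton.s0, SmoothWeight.s0_def, h]
  rcases eq_or_ne v 0 with rfl | hv
  · simp
  · rw [Real.sinc_of_ne_zero hv]; ring

/-- Z22:§5.u025 [Z22 p.27, tex L1487] «If `w ∈ L′₁`, then the right side of (5.13) is
`≤ ½u − (10⁻²𝓛₂ log x)²`» (case `x > t₀^{1.02}`). CLAIM — and a THEOREM of the tree
(`step5u025_holds`, `Lemma53.re_phase_le_L1'`). [cite: Zhang2022LandauSiegel, §5 p.27] -/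
def Step5u025 : Prop :=
  Skeleton.ForAllLarge fun D _ _ => ∀ x : ℝ, Skeleton.t0 D ^ (1.02 : ℝ) < x → ∀ w ∈ segLp1 x,
    (Lemma53.phase (Skeleton.ell2 D) (Skeleton.t0 D) x w).re
      ≤ w.re / 2 - ((1 : ℝ) / 100 * Skeleton.ell2 D * Real.log x) ^ 2

/-- In the case `x > t₀^{1.02}` (`D ≥ 3`): `x ≥ 1`, so `10⁻² log x ≥ 0`. [folklore] -/
private theorem hc_of_lt {D : ℕ} (hD : 3 ≤ D) {x : ℝ} (hx : Skeleton.t0 D ^ (1.02 : ℝ) < x) :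
    1 ≤ x ∧ 0 ≤ (1 : ℝ) / 100 * Real.log x := by
  have h1 : 1 ≤ x := le_of_lt (lt_of_le_of_lt (Real.one_le_rpow (one_le_t0 hD) (by norm_num)) hx)
  exact ⟨h1, mul_nonneg (by norm_num) (Real.log_nonneg h1)⟩

/-- **u025 holds.** [cite: Zhang2022LandauSiegel, §5 p.27] -/
theorem step5u025_holds : Step5u025 := by
  refine Skeleton.ForAllLarge.of_le 3 fun D _ _ hD _ _ x hx w hw => ?_
  obtain ⟨him, hre⟩ := hw
  have hw' : w = (w.re : ℂ) := Complex.ext (by simp) (by simp [him])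
  have h := Lemma53.re_phase_le_L1' (Skeleton.ell2 D) (Skeleton.t0 D) x (hc_of_lt hD hx).2 hre
  rw [← hw'] at h
  exact h

/-- Z22:§5.u026 [Z22 p.27, tex L1491] «For `w ∈ L′₂ ∪ L′₃` we have `xe^u ≥ x^{0.99} > 2t₀` and
`−1/𝓛₂ ≤ v ≤ 0`» (`w = u + iv`; case `x > t₀^{1.02}`). CLAIM.
[cite: Zhang2022LandauSiegel, §5 p.27] -/
def Step5u026 : Prop :=
  Skeleton.ForAllLarge fun D _ _ => ∀ x : ℝ, Skeleton.t0 D ^ (1.02 : ℝ) < x →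
    ∀ w ∈ segLp2 D x ∪ segLp3 D x,
      x ^ (0.99 : ℝ) ≤ x * Real.exp w.re ∧ 2 * Skeleton.t0 D < x ^ (0.99 : ℝ) ∧
        -(1 / Skeleton.ell2 D) ≤ w.im ∧ w.im ≤ 0

/-- Z22:§5.u027 [Z22 p.27, tex L1494] «so that `2π(xe^u sin v/v − t₀) > x^{0.99}`» for
`w = u + iv ∈ L′₂ ∪ L′₃` (case `x > t₀^{1.02}`; "`sin v/v`" read as its continuous extension
`sinc v`, `= 1` at `v = 0`, as the manuscript intends on `L′₂ ∋ −10⁻²log x`). CLAIM (pointwise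
input: `Lemma53.lt_two_pi_mul_sub`). [cite: Zhang2022LandauSiegel, §5 p.27] -/
def Step5u027 : Prop :=
  Skeleton.ForAllLarge fun D _ _ => ∀ x : ℝ, Skeleton.t0 D ^ (1.02 : ℝ) < x →
    ∀ w ∈ segLp2 D x ∪ segLp3 D x,
      x ^ (0.99 : ℝ) < 2 * π * (x * Real.exp w.re * Real.sinc w.im - Skeleton.t0 D)

/-- Z22:§5.u028 [Z22 p.27, tex L1498] «If `w ∈ L′₂`, then `(𝓛₂u)² = (10⁻²𝓛₂ log x)²`, so the right
side of (5.13) is `≤ −(10⁻²𝓛₂ log x)² + O(1)`» (case `x > t₀^{1.02}`; the `O(1)` typed as an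
absolute constant `C`). CLAIM — pointwise input `Lemma53.re_phase_le_L2'` (with `C = 1`).
[cite: Zhang2022LandauSiegel, §5 p.27] -/
def Step5u028 : Prop :=
  ∃ C : ℝ, Skeleton.ForAllLarge fun D _ _ => ∀ x : ℝ, Skeleton.t0 D ^ (1.02 : ℝ) < x →
    ∀ w ∈ segLp2 D x,
      (Skeleton.ell2 D * w.re) ^ 2 = ((1 : ℝ) / 100 * Skeleton.ell2 D * Real.log x) ^ 2 ∧
        (Lemma53.phase (Skeleton.ell2 D) (Skeleton.t0 D) x w).re
          ≤ -((1 : ℝ) / 100 * Skeleton.ell2 D * Real.log x) ^ 2 + C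

/-- Z22:§5.u029 [Z22 p.27, tex L1502] «If `w ∈ L′₃`, then `v = −1/𝓛₂`, and the right side of (5.13)
is `< 1 + ½u − (𝓛₂u)² − x^{0.99}/𝓛₂`» (case `x > t₀^{1.02}`). CLAIM — pointwise input
`Lemma53.re_phase_lt_L3'`. [cite: Zhang2022LandauSiegel, §5 p.27] -/
def Step5u029 : Prop :=
  Skeleton.ForAllLarge fun D _ _ => ∀ x : ℝ, Skeleton.t0 D ^ (1.02 : ℝ) < x →
    ∀ w ∈ segLp3 D x,
      w.im = -(1 / Skeleton.ell2 D) ∧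
        (Lemma53.phase (Skeleton.ell2 D) (Skeleton.t0 D) x w).re
          < 1 + w.re / 2 - (Skeleton.ell2 D * w.re) ^ 2 - x ^ (0.99 : ℝ) / Skeleton.ell2 D

/-- For `x > 0`: `x^{0.99} = x·e^{−10⁻² log x}` (`= xe^{u}` at `u = −10⁻²log x`). [folklore] -/
private theorem rpow099_eq {x : ℝ} (hx : 0 < x) :
    x ^ (0.99 : ℝ) = x * Real.exp (-((1 : ℝ) / 100 * Real.log x)) := by
  rw [Real.rpow_def_of_pos hx]
  nth_rw 2 [← Real.exp_log hx]
  rw [← Real.exp_add]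
  congr 1
  ring

/-- `log D ≥ 2` for `D ≥ 8` (`e² < 8`). [folklore] -/
private theorem two_le_ell {D : ℕ} (hD : 8 ≤ D) : 2 ≤ Skeleton.ell D := by
  have hD' : (8 : ℝ) ≤ D := by exact_mod_cast hD
  rw [Skeleton.ell, Real.le_log_iff_exp_le (by linarith)]
  have h1 : Real.exp 2 = Real.exp 1 ^ 2 := by
    rw [← Real.exp_nat_mul]; norm_num
  have h2 := Real.exp_one_lt_d9
  have h3 := Real.exp_pos 1
  nlinarith

/-- In the case `x > t₀^{1.02}` (`D ≥ 8`): `x^{0.99} > t₀^{1.0098} ≥ 2t₀` (as `t₀^{0.0098} ≥ 2`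
once `t₀ ≥ 2⁵¹⁹`). [cite: Zhang2022LandauSiegel, §5 p.27] -/
private theorem two_t0_lt {D : ℕ} (hD : 8 ≤ D) {x : ℝ} (hx : Skeleton.t0 D ^ (1.02 : ℝ) < x) :
    2 * Skeleton.t0 D < x ^ (0.99 : ℝ) := by
  have ht0 : (2 : ℝ) ^ 519 ≤ Skeleton.t0 D := by
    rw [Skeleton.t0]; exact pow_le_pow_left₀ (by norm_num) (two_le_ell hD) 519
  have ht0pos : 0 < Skeleton.t0 D := lt_of_lt_of_le (by positivity) ht0
  have h1 : (Skeleton.t0 D ^ (1.02 : ℝ)) ^ (0.99 : ℝ) < x ^ (0.99 : ℝ) :=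
    Real.rpow_lt_rpow (Real.rpow_nonneg ht0pos.le _) hx (by norm_num)
  have h2 : (Skeleton.t0 D ^ (1.02 : ℝ)) ^ (0.99 : ℝ)
      = Skeleton.t0 D * Skeleton.t0 D ^ (0.0098 : ℝ) := by
    rw [← Real.rpow_mul ht0pos.le, show (1.02 : ℝ) * 0.99 = 1 + 0.0098 by norm_num,
      Real.rpow_add ht0pos, Real.rpow_one]
  have h3 : (2 : ℝ) ≤ Skeleton.t0 D ^ (0.0098 : ℝ) := by
    have h4 : ((2 : ℝ) ^ 519) ^ (0.0098 : ℝ) ≤ Skeleton.t0 D ^ (0.0098 : ℝ) :=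
      Real.rpow_le_rpow (by positivity) ht0 (by norm_num)
    have h5 : ((2 : ℝ) ^ 519) ^ (0.0098 : ℝ) = (2 : ℝ) ^ ((519 : ℕ) * (0.0098 : ℝ)) := by
      rw [← Real.rpow_natCast (2 : ℝ) 519, ← Real.rpow_mul (by norm_num)]
    have h6 : (2 : ℝ) ^ (1 : ℝ) ≤ (2 : ℝ) ^ ((519 : ℕ) * (0.0098 : ℝ)) :=
      Real.rpow_le_rpow_of_exponent_le (by norm_num) (by norm_num)
    rw [Real.rpow_one] at h6
    linarith
  rw [h2] at h1
  have h4 : Skeleton.t0 D * 2 ≤ Skeleton.t0 D * Skeleton.t0 D ^ (0.0098 : ℝ) :=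
    mul_le_mul_of_nonneg_left h3 ht0pos.le
  linarith

/-- **u026 holds.** [cite: Zhang2022LandauSiegel, §5 p.27] -/
theorem step5u026_holds : Step5u026 := by
  refine Skeleton.ForAllLarge.of_le 8 fun D _ _ hD _ _ x hx w hw => ?_
  have hD3 : 3 ≤ D := le_trans (by norm_num) hD
  have hx0 : 0 < x := lt_of_le_of_lt (Real.rpow_nonneg (t0_nonneg D) _) hx
  have hL := ell2_pos hD3
  have hLinv : 0 ≤ 1 / Skeleton.ell2 D := by positivity
  refine ⟨?_, two_t0_lt hD hx, ?_⟩
  · rw [rpow099_eq hx0]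
    refine mul_le_mul_of_nonneg_left (Real.exp_le_exp.mpr ?_) hx0.le
    rcases hw with ⟨hre, -⟩ | ⟨-, hre⟩
    · exact hre.ge
    · exact hre
  · rcases hw with ⟨-, him⟩ | ⟨him, -⟩
    · exact him
    · rw [him]; exact ⟨le_rfl, by linarith⟩

/-- **u027 holds** (`Lemma53.lt_two_pi_mul_sub` with `X = x^{0.99}`). [cite: Zhang2022LandauSiegel, §5 p.27] -/
theorem step5u027_holds : Step5u027 := by
  obtain ⟨D₀, h26⟩ := step5u026_holds
  refine Skeleton.ForAllLarge.of_le (max D₀ 3) fun D _ χ hD hq hp x hx w hw => ?_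
  have hD3 : 3 ≤ D := le_trans (le_max_right _ _) hD
  have hx0 : 0 < x := lt_of_le_of_lt (Real.rpow_nonneg (t0_nonneg D) _) hx
  obtain ⟨hXle, ht, hv1, hv0⟩ := h26 D χ (le_trans (le_max_left _ _) hD) hq hp x hx w hw
  have hv : |w.im| ≤ 1 := by
    rw [abs_of_nonpos hv0]
    have : 1 / Skeleton.ell2 D ≤ 1 := (div_le_one (ell2_pos hD3)).mpr (one_le_ell2 hD3)
    linarith
  exact Lemma53.lt_two_pi_mul_sub (Real.rpow_pos_of_pos hx0 _) hXle ht hv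

/-- **u028 holds** with the absolute constant `1` for the printed `O(1)` (`Lemma53.re_phase_le_L2'`).
[cite: Zhang2022LandauSiegel, §5 p.27] -/
theorem step5u028_holds : Step5u028 := by
  refine ⟨1, Skeleton.ForAllLarge.of_le 8 fun D _ _ hD _ _ x hx w hw => ?_⟩
  have hD3 : 3 ≤ D := le_trans (by norm_num) hD
  have hx0 : 0 < x := lt_of_le_of_lt (Real.rpow_nonneg (t0_nonneg D) _) hx
  obtain ⟨hre, hv1, hv0⟩ := hw
  refine ⟨by rw [hre]; ring, ?_⟩
  have hw' : w = ((-((1 : ℝ) / 100 * Real.log x) : ℝ) : ℂ) + (w.im : ℂ) * I :=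
    Complex.ext (by simp [hre]) (by simp)
  have h := Lemma53.re_phase_le_L2' (one_le_ell2 hD3) (Skeleton.t0 D) x (hc_of_lt hD3 hx).2 hv1 hv0
    (Real.rpow_pos_of_pos hx0 (0.99 : ℝ)) (le_of_eq (rpow099_eq hx0)) (two_t0_lt hD hx)
  rw [← hw'] at h
  exact h

/-- **u029 holds** (`Lemma53.re_phase_lt_L3'`). [cite: Zhang2022LandauSiegel, §5 p.27] -/
theorem step5u029_holds : Step5u029 := by
  refine Skeleton.ForAllLarge.of_le 8 fun D _ _ hD _ _ x hx w hw => ?_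
  have hD3 : 3 ≤ D := le_trans (by norm_num) hD
  have hx0 : 0 < x := lt_of_le_of_lt (Real.rpow_nonneg (t0_nonneg D) _) hx
  obtain ⟨him, hre⟩ := hw
  refine ⟨him, ?_⟩
  have hw' : w = (w.re : ℂ) + ((-(1 / Skeleton.ell2 D) : ℝ) : ℂ) * I :=
    Complex.ext (by simp) (by simp [him])
  have hXle : x ^ (0.99 : ℝ) ≤ x * Real.exp w.re := by
    rw [rpow099_eq hx0]
    exact mul_le_mul_of_nonneg_left (Real.exp_le_exp.mpr hre) hx0.le
  have h := Lemma53.re_phase_lt_L3' (one_le_ell2 hD3) (Skeleton.t0 D) x w.re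
    (Real.rpow_pos_of_pos hx0 (0.99 : ℝ)) hXle (two_t0_lt hD hx)
  rw [← hw'] at h
  exact h

/-! ## (5.14): the Mellin transform `δ(s)` -/

/-- Z22:(5.14) [Z22 p.27, (5.14), tex L1513] «As a consequence of Lemma 5.3, the Mellin transform
`δ(s) := ∫₀^∞ Δ(x)x^{s−1} dx` (5.14) …» — the defining display, with `Δ = Skeleton.DeltaW` (5.7) and
`δ = Skeleton.deltaW` (the tree's `Lemma53.delta514`, whose integrand is written through (5.10)).
CLAIM — and a THEOREM (`eq514_holds`). [cite: Zhang2022LandauSiegel, §5 (5.14) p.27] -/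
def Eq514 : Prop :=
  Skeleton.ForAllLarge fun D _ _ => ∀ s : ℂ,
    Skeleton.deltaW D s = ∫ x in Ioi (0 : ℝ), Skeleton.DeltaW D x * (x : ℂ) ^ (s - 1)

/-- **(5.14) holds** as a definitional identity ((5.7) = (5.10) on `x > 0`,
`Lemma53.Delta57_eq_Delta510`). [cite: Zhang2022LandauSiegel, §5 (5.14) p.27] -/
theorem eq514_holds : Eq514 := by
  refine Skeleton.ForAllLarge.of_le 3 fun D _ _ hD _ _ s => ?_
  rw [Skeleton.deltaW, Lemma53.delta514]
  refine setIntegral_congr_fun measurableSet_Ioi fun x hx => ?_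
  simp only [Skeleton.DeltaW, Lemma53.Delta57_eq_Delta510 (ell2_pos hD) _ (Set.mem_Ioi.mp hx)]

/-- Z22:(5.14), the claim [Z22 p.27, tex L1515] «… is analytic for `σ > 0`»: `δ` is holomorphic
on `{Re s > 0}`. CLAIM — and a THEOREM of the tree (`eq514analytic_holds`,
`Lemma53.differentiableOn_delta514`). [cite: Zhang2022LandauSiegel, §5 (5.14) p.27] -/
def Eq514analytic : Prop :=
  Skeleton.ForAllLarge fun D _ _ => DifferentiableOn ℂ (Skeleton.deltaW D) {s : ℂ | 0 < s.re}

/-- **"`δ(s)` is analytic for `σ > 0`" holds.** [cite: Zhang2022LandauSiegel, §5 (5.14) p.27] -/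
theorem eq514analytic_holds : Eq514analytic := by
  refine Skeleton.ForAllLarge.of_le 3 fun D _ _ hD _ _ => ?_
  have h : Skeleton.deltaW D = Lemma53.delta514 (Skeleton.ell2 D) (Skeleton.t0 D) := by
    funext s; rfl
  rw [h]
  exact Lemma53.differentiableOn_delta514 (one_le_ell2 hD) _

/-! ## The proof node: Lemma 5.3 from (5.11) and (5.12) -/

/-- Z22:Lem5.3.pf [Z22 pp.26–27, tex L1419–L1508] the manuscript's PROOF of Lemma 5.3, typed as
the deduction it performs: «By the relation … and Cauchy's theorem, the proof of (5.8) is reduced to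
showing (5.11)» and «By Cauchy's theorem, the proof of (5.9) is reduced to showing (5.12)» — i.e.
`Red58 → Eq511 → Red59 → Eq512 → Skeleton.Lemma53` (every antecedent typed in this file; `Red58`,
`Red59` are theorems here). CLAIM (deduction node; refines `Skeleton.Lemma53`).
[cite: Zhang2022LandauSiegel, §5 Lemma 5.3 (proof) pp.26–27] -/
def Ded53 : Prop := Red58 → Eq511 → Red59 → Eq512 → Skeleton.Lemma53


/-! ## Wave 2 (§5 edges): the remaining steps of the proof of Lemma 5.3 discharged from the tree,
and the deduction node `Ded53` kernel-checked -/

/-- `e < 3`. [folklore] -/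
private theorem exp_one_lt_three : Real.exp 1 < 3 := lt_trans Real.exp_one_lt_d9 (by norm_num)

/-- `√(2π) ≤ 3` and `√π ≤ 2`. [folklore] -/
private theorem sqrt_two_pi_le : Real.sqrt (2 * π) ≤ 3 ∧ Real.sqrt π ≤ 2 := by
  constructor
  · rw [Real.sqrt_le_left (by norm_num)]; nlinarith [Real.pi_lt_four]
  · rw [Real.sqrt_le_left (by norm_num)]; nlinarith [Real.pi_lt_four]

/-- `𝓛₂²u*² = 𝓛¹⁰` (`u* = 𝓛₂⁻¹𝓛⁵`). [cite: Zhang2022LandauSiegel, §5 p.26] -/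
private theorem ell2_sq_mul_uStar_sq {D : ℕ} (hD : 3 ≤ D) :
    Skeleton.ell2 D ^ 2 * uStar D ^ 2 = Skeleton.ell D ^ 10 := by
  have hL := (ell2_pos hD).ne'
  rw [uStar, mul_pow, inv_pow, ← mul_assoc, mul_inv_cancel₀ (pow_ne_zero 2 hL), one_mul, ← pow_mul]

/-- `u* ≥ 0`. [folklore] -/
private theorem uStar_nonneg (D : ℕ) : 0 ≤ uStar D := by
  rw [uStar, Skeleton.ell2]
  exact mul_nonneg (inv_nonneg.mpr (pow_nonneg (ell_nonneg D) _)) (pow_nonneg (ell_nonneg D) _)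

/-- The `L₁ ∪ L₅` tail at the manuscript's parameters: `T(u*) ≤ 12·exp(−𝓛¹⁰/2)` (`D ≥ 3`).
[cite: Zhang2022LandauSiegel, §5 p.26] -/
private theorem tail_bound {D : ℕ} (hD : 3 ≤ D) (x : ℝ) :
    ‖intL1 D x‖ + ‖intL5 D x‖ ≤ 12 * Real.exp (-(1 / 2) * Skeleton.ell D ^ 10) := by
  have hL0 := ell2_pos hD
  have hL1 := one_le_ell2 hD
  have h15 := Lemma53.norm_integral_gfun_L15_le hL0.ne' (Skeleton.t0 D) x (uStar D)
  have htail := Lemma53.tail_le hL0 (uStar_nonneg D)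
  rw [intL1, intL5, integral_Ici_eq_integral_Ioi]
  refine h15.trans (htail.trans ?_)
  rw [ell2_sq_mul_uStar_sq hD, show -(Skeleton.ell D ^ 10 / 2) = -(1 / 2) * Skeleton.ell D ^ 10 by ring]
  have e1 : Real.exp (1 / (8 * Skeleton.ell2 D ^ 2)) ≤ 3 := by
    refine le_trans (Real.exp_le_exp.mpr ?_) exp_one_lt_three.le
    rw [div_le_one (by positivity)]; nlinarith
  have e2 : Real.sqrt (2 * π) / Skeleton.ell2 D ≤ 3 :=
    le_trans (div_le_self (Real.sqrt_nonneg _) hL1) sqrt_two_pi_le.1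
  have e0 : 0 ≤ Real.sqrt (2 * π) / Skeleton.ell2 D := by positivity
  have hE : 0 < Real.exp (-(1 / 2) * Skeleton.ell D ^ 10) := Real.exp_pos _
  calc (1 + Real.exp (1 / (8 * Skeleton.ell2 D ^ 2))) * (Real.sqrt (2 * π) / Skeleton.ell2 D)
        * Real.exp (-(1 / 2) * Skeleton.ell D ^ 10)
      ≤ (4 * 3) * Real.exp (-(1 / 2) * Skeleton.ell D ^ 10) := by
        apply mul_le_mul_of_nonneg_right _ hE.le
        exact mul_le_mul (by linarith) e2 e0 (by norm_num)
    _ = 12 * Real.exp (-(1 / 2) * Skeleton.ell D ^ 10) := by norm_num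

/-- **«trivially `O(ε)` if `j = 1, 5`» holds** (`c = 1/2`, `C = 12`, from `Lemma53.tail_le`).
[cite: Zhang2022LandauSiegel, §5 p.26] -/
theorem step5u020tail_holds : Step5u020tail :=
  ⟨1 / 2, by norm_num, 12, Skeleton.ForAllLarge.of_le 3 fun D _ _ hD _ _ x _ _ => tail_bound hD x⟩

/-- Absorbing a constant into `ε`: for `c > 0` and any `A`, eventually
`A·exp(−c𝓛¹⁰) ≤ exp(−(c/2)𝓛¹⁰)`. [folklore] -/
private theorem absorb {c : ℝ} (hc : 0 < c) (A : ℝ) :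
    ∃ D₀ : ℕ, ∀ D : ℕ, D₀ ≤ D →
      A * Real.exp (-c * Skeleton.ell D ^ 10) ≤ Real.exp (-(c / 2) * Skeleton.ell D ^ 10) := by
  set K : ℝ := |A| with hK
  refine ⟨⌈Real.exp (2 * K / c + 1)⌉₊, fun D hD => ?_⟩
  have hK0 : 0 ≤ K := abs_nonneg A
  have hDexp : Real.exp (2 * K / c + 1) ≤ D := le_trans (Nat.le_ceil _) (by exact_mod_cast hD)
  have hℓ : 2 * K / c + 1 ≤ Skeleton.ell D := by
    rw [Skeleton.ell, Real.le_log_iff_exp_le (lt_of_lt_of_le (Real.exp_pos _) hDexp)]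
    exact hDexp
  have hℓ1 : 1 ≤ Skeleton.ell D := by
    have : 0 ≤ 2 * K / c := by positivity
    linarith
  have hℓ10 : Skeleton.ell D ≤ Skeleton.ell D ^ 10 := le_self_pow₀ hℓ1 (by norm_num)
  have hKle : K ≤ c / 2 * Skeleton.ell D ^ 10 := by
    have h1 : 2 * K / c ≤ Skeleton.ell D ^ 10 := by linarith
    have h2 := mul_le_mul_of_nonneg_left h1 (by positivity : 0 ≤ c / 2)
    rw [show c / 2 * (2 * K / c) = K by field_simp] at h2
    exact h2
  have hA : A ≤ Real.exp K := by
    calc A ≤ |A| := le_abs_self A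
      _ ≤ |A| + 1 := by linarith
      _ ≤ Real.exp |A| := Real.add_one_le_exp _
  calc A * Real.exp (-c * Skeleton.ell D ^ 10) ≤ Real.exp K * Real.exp (-c * Skeleton.ell D ^ 10) :=
        mul_le_mul_of_nonneg_right hA (Real.exp_pos _).le
    _ = Real.exp (K + -c * Skeleton.ell D ^ 10) := (Real.exp_add _ _).symm
    _ ≤ Real.exp (-(c / 2) * Skeleton.ell D ^ 10) := Real.exp_le_exp.mpr (by linarith)

/-- **The deduction node Z22:Lem5.3.pf holds**: Lemma 5.3 (the banked node `Skeleton.Lemma53`)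
follows from the two Cauchy reductions and the estimates (5.11), (5.12), exactly as the manuscript
assembles it ("These estimates together imply (5.11)" / "This yields (5.12) with j = 1, 2, 3"), the
`O(ε)`-constants being absorbed into `ε` (`c ↦ c/2`). EDGE, kernel-checked.
[cite: Zhang2022LandauSiegel, §5 Lemma 5.3 (proof) pp.26–27] -/
theorem ded53_holds : Ded53 := by
  rintro ⟨D₁, h58⟩ ⟨c, hc, C₁, D₂, h511⟩ ⟨D₃, h59⟩ ⟨C₂, D₄, h512⟩
  obtain ⟨D₅, hab⟩ := absorb hc (5 * C₁)
  refine ⟨c / 2, by linarith, max (5 * C₁) (3 * C₂),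
    max (max D₁ D₂) (max (max D₃ D₄) D₅), fun D _ χ hD hq hp x hx => ⟨fun hle => ?_, fun hlt => ?_⟩⟩
  · have hD₁ : D₁ ≤ D := le_trans (le_max_left _ _) (le_trans (le_max_left _ _) hD)
    have hD₂ : D₂ ≤ D := le_trans (le_max_right _ _) (le_trans (le_max_left _ _) hD)
    have hD₅ : D₅ ≤ D := le_trans (le_max_right _ _) (le_trans (le_max_right _ _) hD)
    have e58 := h58 D χ hD₁ hq hp x hx
    have e511 := h511 D χ hD₂ hq hp x hx hle
    dsimp only at e511
    obtain ⟨b1, b2, b3, b4, b5⟩ := e511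
    have hαω : 0 ≤ Skeleton.alpha D * ‖Skeleton.omegaW D (1 / 2 + 2 * π * x * I)‖ :=
      mul_nonneg (alpha_nonneg D) (norm_nonneg _)
    rw [e58]
    calc ‖intL1 D x + intL2 D x + intL3 D x + intL4 D x + intL5 D x‖
        ≤ ‖intL1 D x‖ + ‖intL2 D x‖ + ‖intL3 D x‖ + ‖intL4 D x‖ + ‖intL5 D x‖ := by
          refine (norm_add_le _ _).trans (add_le_add ?_ le_rfl)
          refine (norm_add_le _ _).trans (add_le_add ?_ le_rfl)
          refine (norm_add_le _ _).trans (add_le_add ?_ le_rfl)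
          exact norm_add_le _ _
      _ ≤ 5 * C₁ * (Skeleton.alpha D * ‖Skeleton.omegaW D (1 / 2 + 2 * π * x * I)‖)
          + 5 * C₁ * Real.exp (-c * Skeleton.ell D ^ 10) := by linarith
      _ ≤ max (5 * C₁) (3 * C₂) * Skeleton.alpha D * ‖Skeleton.omegaW D (1 / 2 + 2 * π * x * I)‖
          + Real.exp (-(c / 2) * Skeleton.ell D ^ 10) := by
          rw [mul_assoc (max _ _)]
          exact add_le_add (mul_le_mul_of_nonneg_right (le_max_left _ _) hαω) (hab D hD₅)
  · have hD₃ : D₃ ≤ D := le_trans (le_max_left _ _) (le_trans (le_max_left _ _)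
      (le_trans (le_max_right _ _) hD))
    have hD₄ : D₄ ≤ D := le_trans (le_max_right _ _) (le_trans (le_max_left _ _)
      (le_trans (le_max_right _ _) hD))
    have e59 := h59 D χ hD₃ hq hp x hlt
    have e512 := h512 D χ hD₄ hq hp x hlt
    dsimp only at e512
    obtain ⟨b1, b2, b3⟩ := e512
    have hR : 0 ≤ Real.exp (-((1 : ℝ) / 100 * Skeleton.ell2 D * Real.log x) ^ 2) +
        Real.exp (-(x ^ (0.99 : ℝ)) / Skeleton.ell2 D) := by positivity
    rw [e59]
    calc ‖intLp1 D x + intLp2 D x + intLp3 D x‖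
        ≤ ‖intLp1 D x‖ + ‖intLp2 D x‖ + ‖intLp3 D x‖ :=
          (norm_add_le _ _).trans (add_le_add (norm_add_le _ _) le_rfl)
      _ ≤ 3 * C₂ * (Real.exp (-((1 : ℝ) / 100 * Skeleton.ell2 D * Real.log x) ^ 2) +
          Real.exp (-(x ^ (0.99 : ℝ)) / Skeleton.ell2 D)) := by linarith
      _ ≤ max (5 * C₁) (3 * C₂) * (Real.exp (-((1 : ℝ) / 100 * Skeleton.ell2 D * Real.log x) ^ 2) +
          Real.exp (-(x ^ (0.99 : ℝ)) / Skeleton.ell2 D)) :=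
          mul_le_mul_of_nonneg_right (le_max_right _ _) hR

/-- **(5.12) holds** for `j = 1, 2, 3` with `C = 16` (`Lemma53.norm_integral_L1'_le / L2'_le / L3'_le`
at `c = 10⁻²`, `X = x^{0.99}`, `2t₀ < x^{0.99}`). [cite: Zhang2022LandauSiegel, §5 (5.12) p.27] -/
theorem eq512_holds : Eq512 := by
  refine ⟨16, Skeleton.ForAllLarge.of_le 8 fun D _ _ hD _ _ x hx => ?_⟩
  dsimp only
  have hD3 : 3 ≤ D := le_trans (by norm_num) hD
  have hL1 := one_le_ell2 hD3
  have hL0 := ell2_pos hD3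
  have hx0 : 0 < x := lt_of_le_of_lt (Real.rpow_nonneg (t0_nonneg D) _) hx
  have hc := (hc_of_lt hD3 hx).2
  have hX : 0 < x ^ (0.99 : ℝ) := Real.rpow_pos_of_pos hx0 _
  have hXle : x ^ (0.99 : ℝ) ≤ x * Real.exp (-((1 : ℝ) / 100 * Real.log x)) := (rpow099_eq hx0).le
  have ht := two_t0_lt hD hx
  set L := Skeleton.ell2 D with hLdef
  set R₁ := Real.exp (-((1 : ℝ) / 100 * L * Real.log x) ^ 2) with hR₁
  set R₂ := Real.exp (-(x ^ (0.99 : ℝ)) / L) with hR₂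
  have hR₁0 : 0 ≤ R₁ := (Real.exp_pos _).le
  have hR₂0 : 0 ≤ R₂ := (Real.exp_pos _).le
  refine ⟨?_, ?_, ?_⟩
  · have h1 := Lemma53.norm_integral_L1'_le hL0.ne' (Skeleton.t0 D) x hc
    rw [intLp1]
    exact le_trans h1 (by nlinarith)
  · have h2 := Lemma53.norm_integral_L2'_le hL1 (Skeleton.t0 D) x hc hX hXle ht
    rw [intLp2, intervalIntegral.integral_symm (-(1 / L)) 0, mul_neg, norm_neg]
    refine h2.trans ?_
    rw [sub_eq_add_neg, Real.exp_add]
    calc Real.exp 1 * R₁ / L ≤ Real.exp 1 * R₁ := div_le_self (by positivity) hL1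
      _ ≤ 16 * (R₁ + R₂) := by nlinarith [exp_one_lt_three]
  · have h3 := Lemma53.norm_integral_L3'_le hL1 (Skeleton.t0 D) hx0.le hX hXle ht
    rw [intLp3, integral_Ici_eq_integral_Ioi]
    refine h3.trans ?_
    have e1 : Real.exp (1 + 1 / (16 * L ^ 2)) ≤ 8 := by
      have h16 : 1 / (16 * L ^ 2) ≤ 1 := by rw [div_le_one (by positivity)]; nlinarith
      calc Real.exp (1 + 1 / (16 * L ^ 2)) ≤ Real.exp (1 + 1) := Real.exp_le_exp.mpr (by linarith)
        _ = Real.exp 1 * Real.exp 1 := Real.exp_add 1 1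
        _ ≤ 8 := by
            have h9 := Real.exp_one_lt_d9
            have h0 := Real.exp_pos 1
            have hprod : Real.exp 1 * Real.exp 1 ≤ 2.7182818286 * 2.7182818286 :=
              mul_le_mul h9.le h9.le h0.le (by norm_num)
            linarith
    have e2 : Real.sqrt π / L ≤ 2 := le_trans (div_le_self (Real.sqrt_nonneg _) hL1) sqrt_two_pi_le.2
    have e3 : Real.exp (-(x ^ (0.99 : ℝ) / L)) = R₂ := by rw [hR₂, neg_div]
    rw [e3]
    have h0 : 0 ≤ Real.sqrt π / L := by positivity
    calc Real.exp (1 + 1 / (16 * L ^ 2)) * (Real.sqrt π / L) * R₂ ≤ 8 * 2 * R₂ := by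
          apply mul_le_mul_of_nonneg_right _ hR₂0
          exact mul_le_mul e1 e2 h0 (by norm_num)
      _ ≤ 16 * (R₁ + R₂) := by nlinarith


/-- **Parameter bookkeeping for the case `0 < x ≤ t₀^{1.02}`** (`D ≥ 8`, so `𝓛 ≥ 2`): with
`ρ := √(u*² + v*²)` one has `ρ ≤ 𝓛⁻⁹ ≤ 1`, `4πxρ² ≤ 44π𝓛^{−11.86} ≤ 1`, `ρ + 4πxρ² ≤ 45α`, `|v*| ≤ 1`
(the manuscript's "`|w| + x|w|² ≪ α`", "`t₀^{3.06}/𝓛₂⁴ ≪ α`": `u* = 𝓛⁻³⁹⁵`, `|v*| ≤ π𝓛^{529.38−800}`).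
[cite: Zhang2022LandauSiegel, §5 p.26] -/
private theorem case1_params {D : ℕ} (hD : 8 ≤ D) {x : ℝ} (hx0 : 0 < x)
    (hx : x ≤ Skeleton.t0 D ^ (1.02 : ℝ)) :
    Real.sqrt (uStar D ^ 2 + (π * (Skeleton.t0 D - x) / Skeleton.ell2 D ^ 2) ^ 2) ≤ 1 ∧
    4 * π * |x| * Real.sqrt (uStar D ^ 2 + (π * (Skeleton.t0 D - x) / Skeleton.ell2 D ^ 2) ^ 2) ^ 2
      ≤ 1 ∧
    Real.sqrt (uStar D ^ 2 + (π * (Skeleton.t0 D - x) / Skeleton.ell2 D ^ 2) ^ 2) +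
      4 * π * |x| * Real.sqrt (uStar D ^ 2 + (π * (Skeleton.t0 D - x) / Skeleton.ell2 D ^ 2) ^ 2) ^ 2
        ≤ 45 * Skeleton.alpha D ∧
    |π * (Skeleton.t0 D - x) / Skeleton.ell2 D ^ 2| ≤ 1 := by
  set ℓ := Skeleton.ell D with hℓdef
  have hD3 : 3 ≤ D := le_trans (by norm_num) hD
  have hℓ2 : 2 ≤ ℓ := two_le_ell hD
  have hℓ1 : 1 ≤ ℓ := by linarith
  have hℓ0 : 0 < ℓ := by linarith
  set V := π * (Skeleton.t0 D - x) / Skeleton.ell2 D ^ 2 with hVdef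
  set A := uStar D ^ 2 + V ^ 2 with hAdef
  have hA0 : 0 ≤ A := by positivity
  -- closed forms in powers of `ℓ`
  have hT0 : Skeleton.t0 D = ℓ ^ 519 := rfl
  have hL2 : Skeleton.ell2 D = ℓ ^ 400 := rfl
  have hUdef : uStar D = (ℓ ^ 400)⁻¹ * ℓ ^ 5 := rfl
  have hT : Skeleton.t0 D = ℓ ^ (519 : ℝ) := by
    rw [hT0, ← Real.rpow_natCast]; norm_num
  have hT' : Skeleton.t0 D ^ (1.02 : ℝ) = ℓ ^ (529.38 : ℝ) := by
    rw [hT, ← Real.rpow_mul hℓ0.le]; norm_num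
  have hL4 : (Skeleton.ell2 D ^ 2) ^ 2 = ℓ ^ (1600 : ℝ) := by
    rw [hL2, ← pow_mul, ← pow_mul, ← Real.rpow_natCast]; norm_num
  have hU : uStar D = ℓ ^ (-395 : ℝ) := by
    rw [hUdef, ← Real.rpow_natCast ℓ 400, ← Real.rpow_neg hℓ0.le,
      ← Real.rpow_natCast ℓ 5, ← Real.rpow_add hℓ0]
    norm_num
  have hU2 : uStar D ^ 2 = ℓ ^ (-790 : ℝ) := by
    rw [hU, ← Real.rpow_natCast, ← Real.rpow_mul hℓ0.le]; norm_num
  -- `|t₀ − x| ≤ t₀^{1.02}`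
  have ht01 : 1 ≤ Skeleton.t0 D := one_le_t0 hD3
  have ht0le : Skeleton.t0 D ≤ ℓ ^ (529.38 : ℝ) := by
    rw [← hT']; exact Real.self_le_rpow_of_one_le ht01 (by norm_num)
  have hx' : x ≤ ℓ ^ (529.38 : ℝ) := by rw [← hT']; exact hx
  have habs : |Skeleton.t0 D - x| ≤ ℓ ^ (529.38 : ℝ) := by
    rw [abs_sub_le_iff]; constructor <;> linarith
  have hV2 : V ^ 2 ≤ π ^ 2 * ℓ ^ (-541.24 : ℝ) := by
    have e1 : V ^ 2 = π ^ 2 * (Skeleton.t0 D - x) ^ 2 / (Skeleton.ell2 D ^ 2) ^ 2 := by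
      rw [hVdef]; ring
    have e2 : (Skeleton.t0 D - x) ^ 2 ≤ ℓ ^ (1058.76 : ℝ) := by
      have h1 : |Skeleton.t0 D - x| ^ 2 ≤ (ℓ ^ (529.38 : ℝ)) ^ 2 :=
        pow_le_pow_left₀ (abs_nonneg _) habs 2
      rw [sq_abs] at h1
      have h2 : (ℓ ^ (529.38 : ℝ)) ^ 2 = ℓ ^ (1058.76 : ℝ) := by
        rw [← Real.rpow_natCast, ← Real.rpow_mul hℓ0.le]; norm_num
      rw [h2] at h1; exact h1
    have e3 : ℓ ^ (1058.76 : ℝ) / ℓ ^ (1600 : ℝ) = ℓ ^ (-541.24 : ℝ) := by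
      rw [← Real.rpow_sub hℓ0]; norm_num
    rw [e1, hL4, mul_div_assoc, ← e3]
    have h0 : 0 < ℓ ^ (1600 : ℝ) := Real.rpow_pos_of_pos hℓ0 _
    exact mul_le_mul_of_nonneg_left (div_le_div_of_nonneg_right e2 h0.le) (by positivity)
  have hA1 : A ≤ 11 * ℓ ^ (-541.24 : ℝ) := by
    have h1 : ℓ ^ (-790 : ℝ) ≤ ℓ ^ (-541.24 : ℝ) := Real.rpow_le_rpow_of_exponent_le hℓ1 (by norm_num)
    have hπ : π ^ 2 < 10 := by nlinarith [Real.pi_lt_d2, Real.pi_pos]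
    have h0 : 0 ≤ ℓ ^ (-541.24 : ℝ) := Real.rpow_nonneg hℓ0.le _
    calc A = uStar D ^ 2 + V ^ 2 := rfl
      _ ≤ ℓ ^ (-790 : ℝ) + π ^ 2 * ℓ ^ (-541.24 : ℝ) := add_le_add hU2.le hV2
      _ ≤ 11 * ℓ ^ (-541.24 : ℝ) := by nlinarith
  -- smallness
  have hℓ4 : ℓ ^ (-4 : ℝ) ≤ 1 / 16 := by
    rw [Real.rpow_neg hℓ0.le, show (4 : ℝ) = ((4 : ℕ) : ℝ) by norm_num, Real.rpow_natCast,
      inv_eq_one_div]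
    have : (16 : ℝ) ≤ ℓ ^ 4 := by
      have := pow_le_pow_left₀ (by norm_num : (0 : ℝ) ≤ 2) hℓ2 4; norm_num at this; exact this
    exact one_div_le_one_div_of_le (by norm_num) this
  have hA2 : A ≤ ℓ ^ (-18 : ℝ) := by
    have h1 : ℓ ^ (-541.24 : ℝ) = ℓ ^ (-18 : ℝ) * ℓ ^ (-523.24 : ℝ) := by
      rw [← Real.rpow_add hℓ0]; norm_num
    have h2 : ℓ ^ (-523.24 : ℝ) ≤ ℓ ^ (-4 : ℝ) := Real.rpow_le_rpow_of_exponent_le hℓ1 (by norm_num)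
    have h0 : 0 ≤ ℓ ^ (-18 : ℝ) := Real.rpow_nonneg hℓ0.le _
    have h3 : ℓ ^ (-18 : ℝ) * ℓ ^ (-523.24 : ℝ) ≤ ℓ ^ (-18 : ℝ) * (1 / 16) :=
      mul_le_mul_of_nonneg_left (h2.trans hℓ4) h0
    calc A ≤ 11 * ℓ ^ (-541.24 : ℝ) := hA1
      _ = 11 * (ℓ ^ (-18 : ℝ) * ℓ ^ (-523.24 : ℝ)) := by rw [h1]
      _ ≤ ℓ ^ (-18 : ℝ) := by nlinarith
  have hsq : (ℓ ^ (-9 : ℝ)) ^ 2 = ℓ ^ (-18 : ℝ) := by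
    rw [← Real.rpow_natCast, ← Real.rpow_mul hℓ0.le]; norm_num
  have hρ9 : Real.sqrt A ≤ ℓ ^ (-9 : ℝ) := by
    rw [Real.sqrt_le_left (Real.rpow_nonneg hℓ0.le _), hsq]; exact hA2
  have hℓ9 : ℓ ^ (-9 : ℝ) ≤ 1 / 500 := by
    rw [Real.rpow_neg hℓ0.le, show (9 : ℝ) = ((9 : ℕ) : ℝ) by norm_num, Real.rpow_natCast,
      inv_eq_one_div]
    have : (512 : ℝ) ≤ ℓ ^ 9 := by
      have := pow_le_pow_left₀ (by norm_num : (0 : ℝ) ≤ 2) hℓ2 9; norm_num at this; exact this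
    exact one_div_le_one_div_of_le (by norm_num) (by linarith)
  have hℓ90 : 0 ≤ ℓ ^ (-9 : ℝ) := Real.rpow_nonneg hℓ0.le _
  have hα : Skeleton.alpha D = π * ℓ ^ (-9 : ℝ) := by
    have h := alpha_eq D
    rw [← hℓdef] at h
    rw [h, Real.rpow_neg hℓ0.le, show (9 : ℝ) = ((9 : ℕ) : ℝ) by norm_num,
      Real.rpow_natCast, div_eq_mul_inv]
  have hxA : 4 * π * |x| * Real.sqrt A ^ 2 ≤ 44 * π * ℓ ^ (-11.86 : ℝ) := by
    rw [Real.sq_sqrt hA0, abs_of_pos hx0]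
    have h1 : ℓ ^ (529.38 : ℝ) * ℓ ^ (-541.24 : ℝ) = ℓ ^ (-11.86 : ℝ) := by
      rw [← Real.rpow_add hℓ0]; norm_num
    have h2 : x * A ≤ ℓ ^ (529.38 : ℝ) * (11 * ℓ ^ (-541.24 : ℝ)) :=
      mul_le_mul hx' hA1 hA0 (Real.rpow_nonneg hℓ0.le _)
    calc 4 * π * x * A = 4 * π * (x * A) := by ring
      _ ≤ 4 * π * (ℓ ^ (529.38 : ℝ) * (11 * ℓ ^ (-541.24 : ℝ))) :=
          mul_le_mul_of_nonneg_left h2 (by positivity)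
      _ = 44 * π * ℓ ^ (-11.86 : ℝ) := by rw [← h1]; ring
  have h1186 : ℓ ^ (-11.86 : ℝ) ≤ ℓ ^ (-9 : ℝ) := Real.rpow_le_rpow_of_exponent_le hℓ1 (by norm_num)
  have hxA' : 4 * π * |x| * Real.sqrt A ^ 2 ≤ 44 * π * ℓ ^ (-9 : ℝ) :=
    hxA.trans (mul_le_mul_of_nonneg_left h1186 (by positivity))
  refine ⟨hρ9.trans (hℓ9.trans (by norm_num)), ?_, ?_, ?_⟩
  · calc 4 * π * |x| * Real.sqrt A ^ 2 ≤ 44 * π * ℓ ^ (-9 : ℝ) := hxA'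
      _ ≤ 44 * π * (1 / 500) := mul_le_mul_of_nonneg_left hℓ9 (by positivity)
      _ ≤ 1 := by nlinarith [Real.pi_lt_four]
  · rw [hα]
    calc Real.sqrt A + 4 * π * |x| * Real.sqrt A ^ 2 ≤ ℓ ^ (-9 : ℝ) + 44 * π * ℓ ^ (-9 : ℝ) :=
          add_le_add hρ9 hxA'
      _ ≤ 45 * (π * ℓ ^ (-9 : ℝ)) := by
          have h := mul_nonneg (sub_pos.mpr Real.pi_gt_three).le hℓ90
          linarith only [h, hℓ90]
  · have hV1 : V ^ 2 ≤ 1 := by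
      have h1 : V ^ 2 ≤ A := by rw [hAdef]; exact le_add_of_nonneg_left (sq_nonneg _)
      have h2 : ℓ ^ (-18 : ℝ) ≤ 1 := by
        rw [Real.rpow_neg hℓ0.le]
        exact inv_le_one_of_one_le₀ (Real.one_le_rpow hℓ1 (by norm_num))
      linarith only [h1, hA2, h2]
    exact (sq_le_one_iff_abs_le_one V).mp hV1

/-- `‖ω(½ + 2πix)‖ = ω`-profile `omegaLine` (positive real). [cite: Zhang2022LandauSiegel, §5 p.25] -/
private theorem norm_omegaW_half {D : ℕ} (hD : 3 ≤ D) (x : ℝ) :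
    ‖Skeleton.omegaW D (1 / 2 + 2 * π * x * I)‖
      = SmoothWeight.omegaLine (Skeleton.ell2 D) (Skeleton.t0 D) x := by
  have hL0 := ell2_pos hD
  rw [Skeleton.omegaW, SmoothWeight.omega_half_eq hL0.ne',
    Complex.norm_of_nonneg (SmoothWeight.omegaLine_pos hL0 _ _).le]

/-- **(5.11) holds** for `j = 1, …, 5` with `c = 1/2`, `C = 180` (`Lemma53.norm_integral_gfun_L15_le`,
`tail_le`, `norm_integral_gfun_L3_le`, `norm_integral_gfun_L24_le` at `U = u*`, `V = v*`,
`ρ = √(u*² + v*²)`, plus `case1_params`). [cite: Zhang2022LandauSiegel, §5 (5.11) p.26] -/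
theorem eq511_holds : Eq511 := by
  refine ⟨1 / 2, by norm_num, 180, Skeleton.ForAllLarge.of_le 8 fun D _ _ hD _ _ x hx0 hx => ?_⟩
  dsimp only
  have hD3 : 3 ≤ D := le_trans (by norm_num) hD
  have hL0 := ell2_pos hD3
  have hL1 := one_le_ell2 hD3
  have hU := uStar_nonneg D
  obtain ⟨hρ1, hxρ, hB, hV1⟩ := case1_params hD hx0 hx
  set ρ := Real.sqrt (uStar D ^ 2 + (π * (Skeleton.t0 D - x) / Skeleton.ell2 D ^ 2) ^ 2) with hρdef
  set E := Real.exp (-(1 / 2) * Skeleton.ell D ^ 10) with hEdef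
  set W := ‖Skeleton.omegaW D (1 / 2 + 2 * π * x * I)‖ with hWdef
  have hW : W = SmoothWeight.omegaLine (Skeleton.ell2 D) (Skeleton.t0 D) x := norm_omegaW_half hD3 x
  have hW0 : 0 ≤ W := norm_nonneg _
  have hE0 : 0 < E := Real.exp_pos _
  have hα0 := alpha_nonneg D
  have hα4 : Skeleton.alpha D ≤ 4 := by
    rw [alpha_eq]
    have h9 : 1 ≤ Skeleton.ell D ^ 9 := one_le_pow₀ (one_lt_ell hD3).le
    exact le_trans (div_le_self Real.pi_pos.le h9) Real.pi_lt_four.le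
  have hρ0 : 0 ≤ ρ := Real.sqrt_nonneg _
  have hB0 : 0 ≤ ρ + 4 * π * |x| * ρ ^ 2 :=
    add_nonneg hρ0 (mul_nonneg (mul_nonneg (by positivity) (abs_nonneg x)) (sq_nonneg ρ))
  have hexpU : Real.exp (-(Skeleton.ell2 D ^ 2 * uStar D ^ 2)) ≤ E := by
    rw [ell2_sq_mul_uStar_sq hD3]
    exact Real.exp_le_exp.mpr (by nlinarith [pow_nonneg (ell_nonneg D) 10])
  have htail := tail_bound hD3 x
  -- j = 3
  have h3 := Lemma53.norm_integral_gfun_L3_le hL0 (Skeleton.t0 D) x hU le_rfl hρ1 hxρ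
  -- j = 2, 4
  have h2 := Lemma53.norm_integral_gfun_L24_le hL0 (Skeleton.t0 D) x le_rfl hρ1 hxρ
    (a := -uStar D) (Or.inr rfl)
  have h4 := Lemma53.norm_integral_gfun_L24_le hL0 (Skeleton.t0 D) x le_rfl hρ1 hxρ
    (a := uStar D) (Or.inl rfl)
  rw [Complex.ofReal_neg] at h2
  have h24 : (ρ + 4 * π * |x| * ρ ^ 2) * |π * (Skeleton.t0 D - x) / Skeleton.ell2 D ^ 2| *
      Real.exp (-(Skeleton.ell2 D ^ 2 * uStar D ^ 2)) ≤ 180 * E := by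
    calc (ρ + 4 * π * |x| * ρ ^ 2) * |π * (Skeleton.t0 D - x) / Skeleton.ell2 D ^ 2| *
          Real.exp (-(Skeleton.ell2 D ^ 2 * uStar D ^ 2))
        ≤ (45 * Skeleton.alpha D) * 1 * E :=
          mul_le_mul (mul_le_mul hB hV1 (abs_nonneg _) (by positivity)) hexpU
            (Real.exp_pos _).le (by positivity)
      _ ≤ 180 * E := by nlinarith
  have h180 : ∀ y : ℝ, y ≤ 180 * E → y ≤ 180 * (Skeleton.alpha D * W + E) := fun y hy => by
    nlinarith [mul_nonneg hα0 hW0]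
  refine ⟨?_, ?_, ?_, ?_, ?_⟩
  · exact h180 _ (by linarith [norm_nonneg (intL5 D x)])
  · rw [intL2]
    exact h180 _ (h2.trans h24)
  · rw [intL3, vStar]
    refine h3.trans ?_
    rw [← hW]
    calc (ρ + 4 * π * |x| * ρ ^ 2) * W ≤ 45 * Skeleton.alpha D * W :=
          mul_le_mul_of_nonneg_right hB hW0
      _ ≤ 180 * (Skeleton.alpha D * W + E) := by nlinarith [mul_nonneg hα0 hW0]
  · rw [intL4, intervalIntegral.integral_symm 0 (vStar D x), mul_neg, norm_neg, vStar]
    exact h180 _ (h4.trans h24)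
  · exact h180 _ (by linarith [norm_nonneg (intL1 D x)])

/-- On `L₂ ∪ L₃ ∪ L₄`: `|w| ≤ ρ = √(u*² + v*²)`. [cite: Zhang2022LandauSiegel, §5 p.26] -/
private theorem norm_le_rho {D : ℕ} {x : ℝ} {w : ℂ} (hw : w ∈ segL2 D x ∪ segL3 D x ∪ segL4 D x) :
    ‖w‖ ≤ Real.sqrt (uStar D ^ 2 + (π * (Skeleton.t0 D - x) / Skeleton.ell2 D ^ 2) ^ 2) := by
  apply Real.le_sqrt_of_sq_le
  rw [Complex.sq_norm, Complex.normSq_apply]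
  have hv : vStar D x = π * (Skeleton.t0 D - x) / Skeleton.ell2 D ^ 2 := rfl
  rw [← hv]
  have hV : ∀ y : ℝ, y ∈ uIcc 0 (vStar D x) → y * y ≤ vStar D x ^ 2 := by
    intro y hy
    rw [Set.mem_uIcc] at hy
    rcases hy with ⟨h1, h2⟩ | ⟨h1, h2⟩ <;> nlinarith only [h1, h2]
  rcases hw with (⟨hre, him⟩ | ⟨him, hre⟩) | ⟨hre, him⟩
  · have := hV _ him; rw [hre]; nlinarith only [this]
  · rw [him]; obtain ⟨h1, h2⟩ := hre; nlinarith only [h1, h2]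
  · have := hV _ him; rw [hre]; nlinarith only [this]

/-- **u022 holds** (`C = 45`: `Lemma53.norm_fstar_sub_one_le` + `case1_params`).
[cite: Zhang2022LandauSiegel, §5 pp.26–27] -/
theorem step5u022_holds : Step5u022 := by
  refine ⟨45, Skeleton.ForAllLarge.of_le 8 fun D _ _ hD _ _ x hx0 hx w hw => ?_⟩
  obtain ⟨hρ1, hxρ, hB, -⟩ := case1_params hD hx0 hx
  set ρ := Real.sqrt (uStar D ^ 2 + (π * (Skeleton.t0 D - x) / Skeleton.ell2 D ^ 2) ^ 2) with hρdef
  have hwρ : ‖w‖ ≤ ρ := norm_le_rho hw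
  have hw0 : 0 ≤ ‖w‖ := norm_nonneg _
  have hw2 : ‖w‖ ^ 2 ≤ ρ ^ 2 := pow_le_pow_left₀ hw0 hwρ 2
  have hw1 : ‖w‖ ≤ 1 := hwρ.trans hρ1
  have hxabs : |x| = x := abs_of_pos hx0
  have hxw : 4 * π * |x| * ‖w‖ ^ 2 ≤ 1 :=
    le_trans (mul_le_mul_of_nonneg_left hw2 (by positivity)) hxρ
  have hf := Lemma53.norm_fstar_sub_one_le hw1 hxw
  rw [hxabs] at hf hxρ hB
  constructor
  · refine hf.trans ?_
    have : 0 ≤ x * ‖w‖ ^ 2 := by positivity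
    nlinarith [Real.pi_lt_four]
  · have h1 : x * ‖w‖ ^ 2 ≤ x * ρ ^ 2 := mul_le_mul_of_nonneg_left hw2 hx0.le
    have h2 : x * ρ ^ 2 ≤ 4 * π * x * ρ ^ 2 := by
      have : 0 ≤ x * ρ ^ 2 := by positivity
      nlinarith [Real.pi_gt_three]
    linarith


/-- On a vertical segment `Re w = ±u*`, `Im w = y ∈ [0, v*]` (either orientation of the interval):
`|exp{lin(w)}| ≤ e^{−𝓛₂²u*²}`. [cite: Zhang2022LandauSiegel, §5 p.26] -/
private theorem vertical_pointwise {D : ℕ} (hD : 3 ≤ D) (x : ℝ) {a : ℝ} (ha : a = uStar D ∨ a = -uStar D)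
    {y : ℝ} (hy : y ∈ uIcc 0 (vStar D x)) :
    ‖cexp (Lemma53.lin (Skeleton.ell2 D) (Skeleton.t0 D) x (a + y * I))‖
      ≤ Real.exp (-(Skeleton.ell2 D ^ 2 * uStar D ^ 2)) := by
  have hL0 := ell2_pos hD
  have hv : (y - π * (Skeleton.t0 D - x) / Skeleton.ell2 D ^ 2) ^ 2
      ≤ (π * (Skeleton.t0 D - x) / Skeleton.ell2 D ^ 2) ^ 2 := by
    have hv' : vStar D x = π * (Skeleton.t0 D - x) / Skeleton.ell2 D ^ 2 := rfl
    rw [← hv']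
    rw [Set.mem_uIcc] at hy
    rcases hy with ⟨h1, h2⟩ | ⟨h1, h2⟩ <;> nlinarith only [h1, h2]
  have h := Lemma53.norm_cexp_lin_vertical_le hL0.ne' (Skeleton.t0 D) x a hv
  have ha2 : a ^ 2 = uStar D ^ 2 := by
    rcases ha with h | h
    · rw [h]
    · rw [h]; ring
  rw [ha2] at h
  exact h

/-- The arc-length integral over a vertical segment is `≤ e^{−𝓛¹⁰}·|v*| ≤ e^{−𝓛¹⁰}` (`D ≥ 8`).
[cite: Zhang2022LandauSiegel, §5 p.26] -/
private theorem vertical_integral_le {D : ℕ} (hD : 8 ≤ D) {x : ℝ} (hx0 : 0 < x)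
    (hx : x ≤ Skeleton.t0 D ^ (1.02 : ℝ)) {a : ℝ} (ha : a = uStar D ∨ a = -uStar D) :
    (∫ y in uIcc 0 (vStar D x), ‖cexp (Lemma53.lin (Skeleton.ell2 D) (Skeleton.t0 D) x (a + y * I))‖)
      ≤ Real.exp (-1 * Skeleton.ell D ^ 10) := by
  have hD3 : 3 ≤ D := le_trans (by norm_num) hD
  obtain ⟨-, -, -, hV1⟩ := case1_params hD hx0 hx
  have hV1' : |vStar D x - 0| ≤ 1 := by rw [sub_zero]; exact hV1
  have hfin : volume (uIcc (0 : ℝ) (vStar D x)) < ⊤ := by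
    rw [Real.volume_interval]; exact ENNReal.ofReal_lt_top
  have hC : ∀ y ∈ uIcc (0 : ℝ) (vStar D x),
      ‖‖cexp (Lemma53.lin (Skeleton.ell2 D) (Skeleton.t0 D) x (a + y * I))‖‖
        ≤ Real.exp (-(Skeleton.ell2 D ^ 2 * uStar D ^ 2)) := fun y hy => by
    rw [norm_norm]; exact vertical_pointwise hD3 x ha hy
  have h := norm_setIntegral_le_of_norm_le_const hfin hC
  rw [Real.volume_real_interval, ell2_sq_mul_uStar_sq hD3] at h
  have hE : 0 < Real.exp (-(Skeleton.ell D ^ 10)) := Real.exp_pos _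
  calc (∫ y in uIcc 0 (vStar D x), ‖cexp (Lemma53.lin (Skeleton.ell2 D) (Skeleton.t0 D) x (a + y * I))‖)
      ≤ ‖∫ y in uIcc 0 (vStar D x),
          ‖cexp (Lemma53.lin (Skeleton.ell2 D) (Skeleton.t0 D) x (a + y * I))‖‖ := Real.le_norm_self _
    _ ≤ Real.exp (-(Skeleton.ell D ^ 10)) * |vStar D x - 0| := h
    _ ≤ Real.exp (-(Skeleton.ell D ^ 10)) * 1 := mul_le_mul_of_nonneg_left hV1' hE.le
    _ = Real.exp (-1 * Skeleton.ell D ^ 10) := by rw [mul_one, neg_one_mul]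

/-- The arc-length integral over `L₃` equals the Gaussian profile cut off to `[−u*, u*]`, hence is
`≤ ω(½ + 2πix)`. [cite: Zhang2022LandauSiegel, §5 p.26] -/
private theorem horizontal_integral_le {D : ℕ} (hD : 3 ≤ D) (x : ℝ) :
    (∫ u in Icc (-uStar D) (uStar D),
        ‖cexp (Lemma53.lin (Skeleton.ell2 D) (Skeleton.t0 D) x (u + vStar D x * I))‖)
      ≤ ‖Skeleton.omegaW D (1 / 2 + 2 * π * x * I)‖ := by
  have hL0 := ell2_pos hD
  set L := Skeleton.ell2 D with hLdef
  set K := Real.exp (-(π * (Skeleton.t0 D - x) / L) ^ 2) with hKdef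
  have hv : vStar D x = π * (Skeleton.t0 D - x) / L ^ 2 := rfl
  have hpt : ∀ u : ℝ, ‖cexp (Lemma53.lin L (Skeleton.t0 D) x (u + vStar D x * I))‖
      = K * Real.exp (-L ^ 2 * u ^ 2) := fun u => by
    rw [hv, Lemma53.norm_cexp_lin_saddle hL0.ne', hKdef, neg_mul, mul_comm]
  simp_rw [hpt]
  have hint : Integrable fun u : ℝ => K * Real.exp (-L ^ 2 * u ^ 2) :=
    (integrable_exp_neg_mul_sq (by positivity : 0 < L ^ 2)).const_mul K
  have hnn : 0 ≤ᵐ[volume] fun u : ℝ => K * Real.exp (-L ^ 2 * u ^ 2) :=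
    Filter.Eventually.of_forall fun u => by positivity
  refine (setIntegral_le_integral hint hnn).trans ?_
  rw [MeasureTheory.integral_const_mul, integral_gaussian, Real.sqrt_div' _ (by positivity : 0 ≤ L ^ 2),
    Real.sqrt_sq hL0.le, norm_omegaW_half hD x, SmoothWeight.omegaLine_def]
  apply le_of_eq
  rw [hKdef]
  have : (π * (x - Skeleton.t0 D) / L) ^ 2 = (π * (Skeleton.t0 D - x) / L) ^ 2 := by ring
  rw [this]
  ring

/-- **u021 («by simple estimates») holds** with `c = 1`, `C = 1`.
[cite: Zhang2022LandauSiegel, §5 p.26] -/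
theorem step5u021_holds : Step5u021 := by
  refine ⟨1, by norm_num, 1, Skeleton.ForAllLarge.of_le 8 fun D _ _ hD _ _ x hx0 hx => ?_⟩
  dsimp only
  have hD3 : 3 ≤ D := le_trans (by norm_num) hD
  have hW0 : 0 ≤ ‖Skeleton.omegaW D (1 / 2 + 2 * π * x * I)‖ := norm_nonneg _
  have hE0 : 0 ≤ Real.exp (-1 * Skeleton.ell D ^ 10) := (Real.exp_pos _).le
  have h2 := vertical_integral_le hD hx0 hx (a := -uStar D) (Or.inr rfl)
  have h4 := vertical_integral_le hD hx0 hx (a := uStar D) (Or.inl rfl)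
  have h3 := horizontal_integral_le hD3 x
  simp only [Complex.ofReal_neg] at h2
  rw [one_mul]
  exact ⟨h2.trans (by linarith), h3.trans (by linarith), h4.trans (by linarith)⟩


/-- **u013 holds**: the Mellin/Laplace form of `Δ₁(x)` (5.6), obtained here from the tree's
(5.6)–(5.7) ⇒ (5.10) (`Lemma53.Delta57_eq_Delta510`) by undoing the substitution `y = e^u` (change of
variables `u ↦ e^u : ℝ → (0, ∞)`, Mathlib's `integral_image_eq_integral_abs_deriv_smul`); no use of
the unheld [1]. [cite: Zhang2022LandauSiegel, §5 p.26] -/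
theorem step5u013_holds : Step5u013 := by
  refine Skeleton.ForAllLarge.of_le 3 fun D _ _ hD _ _ x hx => ?_
  have hL := ell2_pos hD
  have h1 : Lemma53.Delta1_56 (Skeleton.ell2 D) (Skeleton.t0 D) x
      = Lemma53.Delta510 (Skeleton.ell2 D) (Skeleton.t0 D) x * cexp (-(2 * π * I * x)) := by
    rw [← Lemma53.Delta57_eq_Delta510 hL _ hx, Lemma53.Delta57, mul_assoc, ← Complex.exp_add,
      add_neg_cancel, Complex.exp_zero, mul_one]
  rw [h1, Lemma53.Delta510, ← MeasureTheory.integral_mul_const]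
  have hcov := integral_image_eq_integral_abs_deriv_smul MeasurableSet.univ
    (f := Real.exp) (f' := Real.exp) (fun u _ => (Real.hasDerivAt_exp u).hasDerivWithinAt)
    Real.exp_injective.injOn
    (fun y : ℝ => cexp ((Skeleton.s0 D - 1) * (Real.log y : ℂ)
      - (Skeleton.ell2 D : ℂ) ^ 2 * (Real.log y : ℂ) ^ 2 - 2 * π * I * x * y))
  rw [Set.image_univ, Real.range_exp, Measure.restrict_univ] at hcov
  rw [hcov]
  congr 1
  funext u
  rw [abs_of_pos (Real.exp_pos u), Real.log_exp, Complex.real_smul, Complex.ofReal_exp,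
    Lemma53.phase_def, ← Complex.exp_add, ← Complex.exp_add]
  congr 1
  rw [Skeleton.s0, SmoothWeight.s0_def]
  ring


/-- **(5.8) holds**: from the tree's discharge of the banked node, `Skeleton.lemma53_holds`
(`Section5Lemma53`, discharger d03), through the bridge `lemma53_iff`.
[cite: Zhang2022LandauSiegel, §5 Lemma 5.3 (5.8) p.25] -/
theorem eq58_holds : Eq58 := (lemma53_iff.mp Skeleton.lemma53_holds).1

/-- **(5.9) holds** (likewise). [cite: Zhang2022LandauSiegel, §5 Lemma 5.3 (5.9) p.25] -/
theorem eq59_holds : Eq59 := (lemma53_iff.mp Skeleton.lemma53_holds).2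

end Literature.NumberTheory.LFunctions.Zhang2022.Section5
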